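import Mathlib
import Literature.NumberTheory.Congruences.BernoulliKummerCongruence
import Literature.NumberTheory.Congruences.LjunggrenBinomialCongruence
import HarnessLib

/-!
# Glaisher's congruences `Σ_{k=1}^{p−1} 1/k² ≡ (2/3) p B_{p−3} (mod p²)` and `Σ_{k=1}^{p−1} 1/k ≡ −(1/3) p² B_{p−3} (mod p³)` (Glaisher 1900)

Topic `Literature/NumberTheory/Congruences`.  PROOF FILE: sorry-free theorems only — no definition, no named fact.

## Source, as printed — R. Meštrović, *Wolstenholme's theorem: its generalizations and extensions in the last
hundred and fifty years (1862–2012)*, arXiv:1111.3057 [Mestrovic2011] (held text `paper:arxiv-1111.3057`, p. 6):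

«In 1900 J.W.L. Glaisher ([gl2]; also see [gl3]) proved the following generalizations of the congruences (18) and
(19) … if `m` is a positive integer and `p` a prime such that `p ≥ m + 3`, then
(20) `Σ_{k=1}^{p−1} 1/k^m ≡ (m/(m+1)) p B_{p−1−m} (mod p²)` if `m` is even,
`≡ −(m(m+1)/(2(m+2))) p² B_{p−2−m} (mod p³)` if `m` is odd. … In particular, taking `m = 1, 2, 3` into the
congruence (20) we obtain that for each prime `p ≥ 5`
`Σ_{k=1}^{p−1} 1/k ≡ −(1/3) p² B_{p−3} (mod p³)`, `Σ_{k=1}^{p−1} 1/k² ≡ (2/3) p B_{p−3} (mod p²)` …»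

This file proves the cases `m = 2` and `m = 1` of (20): **`Σ_{k=1}^{p−1} 1/k² ≡ (2/3) p B_{p−3} (mod p²)`** and
**`Σ_{k=1}^{p−1} 1/k ≡ −(1/3) p² B_{p−3} (mod p³)`** for every prime `p ≥ 5`, stated — as in the tree's
`BernoulliKummerCongruence.lean` — as bounds on the `p`-adic valuation of the difference of the two (p-integral)
rationals: `v_p(Σ 1/k² − (2/3)pB_{p−3}) ≤ exp(−2)`, `v_p(Σ 1/k + (1/3)p²B_{p−3}) ≤ exp(−3)`.

## Route (elementary given the tree; not Glaisher's own)

* `1/k² ≡ k^{p−3}(2 − k^{p−1}) (mod p²)` for `0 < k < p` — exactly: `1/k² − k^{p−3}(2 − k^{p−1}) = p²q²/k²` with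
  `k^{p−1} = 1 + pq` (Fermat);
* hence `Σ 1/k² ≡ 2 S_{p−3}(p) − S_{2p−4}(p) (mod p²)`, `S_m(p) = Σ_{t<p} t^m`, and `S_m(p) ≡ p B_m (mod p²)` for even
  `m ≥ 2` (Ireland–Rosen Prop. 15.2.2, the tree's `Voronoi.padicValuation_sum_range_pow_sub_le`);
* Kummer's congruence at `(m, m') = (p−3, 2p−4)` (the tree's `KummerCongruence.kummer_congruence_one`) and Adams'
  `p`-integrality of `B_{p−3}` (`KummerCongruence.padicValuation_bernoulli_div_le_one`) give
  `p B_{2p−4} ≡ (4/3) p B_{p−3} (mod p²)`, since `(2p−4)/(p−3) − 4/3 = 2p/(3(p−3))`.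

## What is formalised (everything PROVED)

* `padicValuation_inv_sq_sub_le` (the termwise congruence) and `padicValuation_kummer_step_le` (the Kummer/Adams
  step), with private valuation/summation helpers;
* **`padicValuation_sum_inv_sq_sub_le`** — Glaisher's congruence (20) at `m = 2`, as printed for `p ≥ 5`;
* (appendix, same filing session) `padicValuation_pairing_le` (`1/(k(p−k)) + 1/k² + p/k³ = −p²/(k³(k−p))`) and
  **`padicValuation_harmonic_add_le`** — (20) at `m = 1`: `Σ 1/k ≡ −(1/3)p²B_{p−3} (mod p³)`, from `m = 2` by the
  pairing `2H_{p−1} = p Σ 1/(k(p−k))` and `Σ 1/k³ ≡ Σ k^{p−4} ≡ 0 (mod p)`.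

* (Appendix B, zeta5-irr lit seat) the BERNOULLI FORMS of the tree's Bernoulli-free binomial congruences
  (`LjunggrenBinomialCongruence.lean`) via (21): Glaisher's (13) `C(np−1,p−1) ≡ 1 − ⅓n(n−1)p³B_{p−3} (mod p⁴)`
  (`padicValuation_choose_mul_prime_sub_one_sub_le`) and (12) (`padicValuation_choose_two_mul_sub_le`),
  Helou–Terjanian's (40) `C(np,mp) ≡ C(n,m)(1 − ⅓mn(n−m)p³B_{p−3}) (mod p⁴)` (`padicValuation_choose_mul_prime_sub_le`),
  Zhao's remark `w_p ≡ −⅓B_{p−3} (mod p)` [Zhao2007, Def. 3.1] (`padicValuation_wp_add_le`) and the second clause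
  of [Zhao2007, Thm. 3.2] «C(np,rp)/C(n,r) ≡ 1 (mod p⁴) for all n, r iff p ∣ numerator(B_{p−3})»
  (`forall_padicValuation_choose_mul_prime_sub_le_iff`).

* (Appendix C, zeta5-irr lit seat, 2026-08-27) **the general (20)**: `padicValuation_sum_inv_pow_sub_le` (every EVEN
  `m ≥ 2`, `p ≥ m+3`: `Σ 1/k^m ≡ (m/(m+1)) p B_{p−1−m} (mod p²)`, with the termwise Fermat-quotient congruence
  `padicValuation_inv_pow_sub_le` and the Kummer/Adams step `padicValuation_kummer_step_le_gen`) and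
  `padicValuation_sum_inv_pow_add_le_of_odd` (every ODD `m ≥ 3`, `p ≥ m+3`:
  `Σ 1/k^m ≡ −(m(m+1)/(2(m+2))) p² B_{p−2−m} (mod p³)`, with Glaisher's second-order pairing
  `padicValuation_pairing_pow_le`).

Not covered: Z.-H. Sun's `mod p⁴` refinements (Remark 9).  Nearest existing declarations (used, not restated): the tree's Kummer/Voronoi files above,
`Wolstenholme.dvd_num_sum_inv_sq` (Hardy–Wright Thm 117: the `mod p` statement), Mathlib's `Rat.padicValuation`.
-/

namespace Literature.NumberTheory.Congruences.Glaisher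

open Finset WithZero
open Literature.NumberTheory.Congruences.KummerCongruence (kummer_congruence_one
  padicValuation_bernoulli_div_le_one)
open Literature.NumberTheory.Congruences.Voronoi (padicValuation_sum_range_pow_sub_le)

variable {p : ℕ} [hp : Fact p.Prime]

/-! ## Valuation bookkeeping -/

/-- `v_p(n) = 1` for a natural number `n` prime to `p`. [folklore] -/
private theorem padicValuation_natCast_eq_one {n : ℕ} (hn : ¬ p ∣ n) : Rat.padicValuation p (n : ℚ) = 1 := by
  rw [← Int.cast_natCast, Rat.padicValuation_cast, Int.padicValuation_eq_one_iff, Int.natCast_dvd_natCast]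
  exact hn

/-- `v_p(1/n) = 1` for a natural number `n` prime to `p`. [folklore] -/
private theorem padicValuation_inv_natCast {n : ℕ} (hn : ¬ p ∣ n) : Rat.padicValuation p ((n : ℚ)⁻¹) = 1 := by
  rw [map_inv₀, padicValuation_natCast_eq_one hn, inv_one]

/-- `v_p(z) ≤ 1` for an integer `z`. [folklore] -/
private theorem padicValuation_intCast_le_one (z : ℤ) : Rat.padicValuation p (z : ℚ) ≤ 1 := by
  rw [Rat.padicValuation_cast]; exact Int.padicValuation_le_one p z

/-- `v_p(n) ≤ 1` for a natural number `n`. [folklore] -/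
private theorem padicValuation_natCast_le_one (n : ℕ) : Rat.padicValuation p (n : ℚ) ≤ 1 := by
  rw [← Int.cast_natCast]; exact padicValuation_intCast_le_one (n : ℤ)

/-- `v_p(p²) = exp(−2)`. [folklore] -/
private theorem padicValuation_prime_sq : Rat.padicValuation p ((p : ℚ) ^ 2) = exp (-2) := by
  rw [map_pow, Rat.padicValuation_self, ← exp_nsmul]; norm_num

/-! ## The termwise congruence `1/k² ≡ k^{p−3}(2 − k^{p−1}) (mod p²)` -/

/-- For `0 < k < p` (`p ≥ 3`): `v_p(1/k² − k^{p−3}(2 − k^{p−1})) ≤ exp(−2)`; indeed the difference is `p²q²/k²`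
with `k^{p−1} = 1 + pq` (Fermat). [cite: Mestrovic2011, eq. (20) (proof input, Fermat quotient)] -/
theorem padicValuation_inv_sq_sub_le (h3 : 3 ≤ p) {k : ℕ} (hk1 : 1 ≤ k) (hkp : k < p) :
    Rat.padicValuation p (((k : ℚ)⁻¹) ^ 2 - (k : ℚ) ^ (p - 3) * (2 - (k : ℚ) ^ (p - 1))) ≤ exp (-2) := by
  have hpk : ¬ p ∣ k := fun h ↦ by have := Nat.le_of_dvd (by omega) h; omega
  have hk0 : (k : ℚ) ≠ 0 := by exact_mod_cast (show k ≠ 0 by omega)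
  -- Fermat: `k^{p−1} = 1 + p q`
  have hcop : IsCoprime (k : ℤ) (p : ℤ) :=
    Nat.isCoprime_iff_coprime.2 ((Nat.Prime.coprime_iff_not_dvd hp.out).2 hpk).symm
  obtain ⟨q, hq⟩ := (Int.ModEq.pow_card_sub_one_eq_one hp.out hcop).symm.dvd
  have hF : (k : ℚ) ^ (p - 1) = 1 + (p : ℚ) * q := by
    have h := congrArg (Int.cast (R := ℚ)) hq
    push_cast at h
    linear_combination h
  -- the exact identity
  set a : ℚ := (k : ℚ) ^ (p - 3) with ha
  have hsplit : (k : ℚ) ^ (p - 1) = a * (k : ℚ) ^ 2 := by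
    rw [ha, ← pow_add]; congr 1; omega
  have hid : ((k : ℚ)⁻¹) ^ 2 - a * (2 - (k : ℚ) ^ (p - 1)) = (p : ℚ) ^ 2 * ((q : ℚ) ^ 2 * ((k : ℚ)⁻¹) ^ 2) := by
    have h1 : ((k : ℚ)⁻¹) ^ 2 - a * (2 - a * (k : ℚ) ^ 2) = (1 - a * (k : ℚ) ^ 2) ^ 2 * ((k : ℚ)⁻¹) ^ 2 := by
      field_simp
      ring
    have h2 : 1 - a * (k : ℚ) ^ 2 = -((p : ℚ) * q) := by rw [← hsplit, hF]; ring
    rw [hsplit, h1, h2]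
    ring
  rw [hid, map_mul, padicValuation_prime_sq, map_mul, map_pow, map_pow, padicValuation_inv_natCast hpk, one_pow,
    mul_one]
  have hq1 := padicValuation_intCast_le_one (p := p) q
  have hq2 : Rat.padicValuation p (q : ℚ) ^ 2 ≤ 1 := by
    calc Rat.padicValuation p (q : ℚ) ^ 2 ≤ 1 ^ 2 := by gcongr
      _ = 1 := one_pow 2
  calc exp (-2) * Rat.padicValuation p (q : ℚ) ^ 2 ≤ exp (-2) * 1 := by gcongr
    _ = exp (-2) := mul_one _

/-! ## The summation identity and the Kummer/Adams step -/

omit hp in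
/-- `Σ_{0<k<p} k^{p−3}(2 − k^{p−1}) = 2 S_{p−3}(p) − S_{2p−4}(p)` with `S_m(p) = Σ_{t<p} t^m` (`p ≥ 4`). [folklore] -/
private theorem sum_Ico_pow_mul_eq (h4 : 4 ≤ p) :
    ∑ k ∈ Ico 1 p, (k : ℚ) ^ (p - 3) * (2 - (k : ℚ) ^ (p - 1)) =
      2 * ∑ t ∈ range p, (t : ℚ) ^ (p - 3) - ∑ t ∈ range p, (t : ℚ) ^ (2 * p - 4) := by
  have h0 : ∀ f : ℕ → ℚ, f 0 = 0 → ∑ t ∈ range p, f t = ∑ t ∈ Ico 1 p, f t := by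
    intro f hf
    rw [Finset.range_eq_Ico, Finset.sum_eq_sum_Ico_succ_bot (by omega), hf, zero_add]
  rw [h0 (fun t => (t : ℚ) ^ (p - 3)) (by simp; omega), h0 (fun t => (t : ℚ) ^ (2 * p - 4)) (by simp; omega),
    Finset.mul_sum, ← Finset.sum_sub_distrib]
  refine Finset.sum_congr rfl fun k _ ↦ ?_
  have e : (k : ℚ) ^ (2 * p - 4) = (k : ℚ) ^ (p - 3) * (k : ℚ) ^ (p - 1) := by
    rw [← pow_add]; congr 1; omega
  rw [e]; ring

/-- **The Kummer/Adams step**: for a prime `p ≥ 5`, `v_p((4/3) p B_{p−3} − p B_{2p−4}) ≤ exp(−2)`, from Kummer's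
congruence `B_{p−3}/(p−3) ≡ B_{2p−4}/(2p−4) (mod p)` and the `p`-integrality of `B_{p−3}`
(`(2p−4)/(p−3) − 4/3 = 2p/(3(p−3))`). [cite: IrelandRosen1982, Ch. 15 §2 Thm. 5 and Prop. 15.2.4 (inputs)] -/
theorem padicValuation_kummer_step_le (h5 : 5 ≤ p) :
    Rat.padicValuation p ((4 / 3 : ℚ) * p * bernoulli (p - 3) - p * bernoulli (2 * p - 4)) ≤ exp (-2) := by
  have hodd : Odd p := hp.out.odd_of_ne_two (by omega)
  have hev : Even (p - 3) := Nat.Odd.sub_odd hodd (by decide)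
  have hnd : ¬ (p - 1) ∣ (p - 3) := fun h ↦ by have := Nat.le_of_dvd (by omega) h; omega
  have hmm : p - 3 ≡ 2 * p - 4 [MOD p - 1] := by
    rw [show 2 * p - 4 = (p - 3) + (p - 1) by omega]; exact (Nat.add_modEq_right).symm
  have hK := kummer_congruence_one (p := p) hev hnd hmm
  have hA := padicValuation_bernoulli_div_le_one (p := p) hev hnd
  -- names
  set B₁ := bernoulli (p - 3) with hB₁
  set B₂ := bernoulli (2 * p - 4) with hB₂
  have hm : ((p - 3 : ℕ) : ℚ) = (p : ℚ) - 3 := by rw [Nat.cast_sub (by omega)]; norm_num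
  have hm' : ((2 * p - 4 : ℕ) : ℚ) = 2 * (p : ℚ) - 4 := by rw [Nat.cast_sub (by omega)]; push_cast; ring
  rw [hm] at hK hA
  rw [hm'] at hK
  have hm0 : (p : ℚ) - 3 ≠ 0 := by
    have : (3 : ℚ) < p := by exact_mod_cast (show 3 < p by omega)
    linarith
  have hm0' : 2 * (p : ℚ) - 4 ≠ 0 := by
    have : (2 : ℚ) < p := by exact_mod_cast (show 2 < p by omega)
    linarith
  have h3 : (3 : ℚ) ≠ 0 := by norm_num
  -- the identity
  have e1 : (2 * (p : ℚ) - 4) * (B₂ / (2 * (p : ℚ) - 4)) = B₂ := mul_div_cancel₀ _ hm0'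
  have e2 : ((p : ℚ) - 3) * (B₁ / ((p : ℚ) - 3)) = B₁ := mul_div_cancel₀ _ hm0
  have hid : (4 / 3 : ℚ) * p * B₁ - p * B₂ =
      p * (2 * (p : ℚ) - 4) * (B₁ / ((p : ℚ) - 3) - B₂ / (2 * (p : ℚ) - 4)) -
        (p : ℚ) ^ 2 * ((2 / 3 : ℚ) * (B₁ / ((p : ℚ) - 3))) := by
    linear_combination (p : ℚ) * e1 - (4 / 3 : ℚ) * p * e2
  rw [hid]
  -- valuations of the two pieces
  have hp1 : Rat.padicValuation p (p : ℚ) = exp (-1) := Rat.padicValuation_self p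
  have hv3 : Rat.padicValuation p (3 : ℚ) = 1 := by
    have h := padicValuation_natCast_eq_one (p := p) (n := 3)
      (fun h ↦ by have := Nat.le_of_dvd (by norm_num) h; omega)
    exact_mod_cast h
  have hvm : Rat.padicValuation p ((p : ℚ) - 3) = 1 := by
    rw [← hm]
    exact padicValuation_natCast_eq_one fun h ↦ by have := Nat.le_of_dvd (by omega) h; omega
  have hv2 : Rat.padicValuation p (2 : ℚ) ≤ 1 := by exact_mod_cast padicValuation_natCast_le_one (p := p) 2
  have hvm' : Rat.padicValuation p (2 * (p : ℚ) - 4) ≤ 1 := by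
    rw [← hm']; exact padicValuation_natCast_le_one _
  refine Valuation.map_sub_le _ ?_ ?_
  · rw [map_mul, map_mul, hp1]
    calc exp (-1) * Rat.padicValuation p (2 * (p : ℚ) - 4) *
          Rat.padicValuation p (B₁ / ((p : ℚ) - 3) - B₂ / (2 * (p : ℚ) - 4))
        ≤ exp (-1) * 1 * exp (-1) := by gcongr
      _ = exp (-2) := by rw [mul_one, ← exp_add]; norm_num
  · rw [map_mul, padicValuation_prime_sq, map_mul, map_div₀, hv3, div_one]
    calc exp (-2) * (Rat.padicValuation p 2 * Rat.padicValuation p (B₁ / ((p : ℚ) - 3)))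
        ≤ exp (-2) * (1 * 1) := by gcongr
      _ = exp (-2) := by rw [mul_one, mul_one]

/-! ## Glaisher's congruence -/

/-- **Glaisher (1900): `Σ_{k=1}^{p−1} 1/k² ≡ (2/3) p B_{p−3} (mod p²)` for every prime `p ≥ 5`**, i.e.
`v_p(Σ_{0<k<p} k⁻² − (2/3) p B_{p−3}) ≤ exp(−2)`. [cite: Mestrovic2011, eq. (20) at m = 2 (Glaisher 1900 [gl2])] -/
theorem padicValuation_sum_inv_sq_sub_le (h5 : 5 ≤ p) :
    Rat.padicValuation p (∑ k ∈ Ico 1 p, ((k : ℚ)⁻¹) ^ 2 - (2 / 3 : ℚ) * p * bernoulli (p - 3)) ≤ exp (-2) := by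
  have hodd : Odd p := hp.out.odd_of_ne_two (by omega)
  -- the four pieces
  set A : ℚ := ∑ k ∈ Ico 1 p, (((k : ℚ)⁻¹) ^ 2 - (k : ℚ) ^ (p - 3) * (2 - (k : ℚ) ^ (p - 1))) with hAdef
  set D₁ : ℚ := (∑ t ∈ range p, (t : ℚ) ^ (p - 3)) - p * bernoulli (p - 3) with hD₁
  set D₂ : ℚ := (∑ t ∈ range p, (t : ℚ) ^ (2 * p - 4)) - p * bernoulli (2 * p - 4) with hD₂
  set L : ℚ := (4 / 3 : ℚ) * p * bernoulli (p - 3) - p * bernoulli (2 * p - 4) with hL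
  have hAv : Rat.padicValuation p A ≤ exp (-2) :=
    Valuation.map_sum_le _ fun k hk ↦ by
      rw [Finset.mem_Ico] at hk
      exact padicValuation_inv_sq_sub_le (by omega) hk.1 hk.2
  have hD₁v : Rat.padicValuation p D₁ ≤ exp (-2) :=
    padicValuation_sum_range_pow_sub_le h5 (Nat.Odd.sub_odd hodd (by decide)) (by omega)
  have hD₂v : Rat.padicValuation p D₂ ≤ exp (-2) :=
    padicValuation_sum_range_pow_sub_le h5 (by rw [show 2 * p - 4 = 2 * (p - 2) by omega]; exact even_two_mul _)
      (by omega)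
  have hLv : Rat.padicValuation p L ≤ exp (-2) := padicValuation_kummer_step_le h5
  have hv2 : Rat.padicValuation p (2 : ℚ) ≤ 1 := by exact_mod_cast padicValuation_natCast_le_one (p := p) 2
  -- the decomposition
  have hA : A = (∑ k ∈ Ico 1 p, ((k : ℚ)⁻¹) ^ 2) -
      (2 * ∑ t ∈ range p, (t : ℚ) ^ (p - 3) - ∑ t ∈ range p, (t : ℚ) ^ (2 * p - 4)) := by
    rw [hAdef, Finset.sum_sub_distrib, sum_Ico_pow_mul_eq (by omega)]
  have key : (∑ k ∈ Ico 1 p, ((k : ℚ)⁻¹) ^ 2) - (2 / 3 : ℚ) * p * bernoulli (p - 3) =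
      A + (2 * D₁ - D₂) + L := by
    rw [hA, hD₁, hD₂, hL]; ring
  rw [key]
  refine Valuation.map_add_le _ (Valuation.map_add_le _ hAv (Valuation.map_sub_le _ ?_ hD₂v)) hLv
  rw [map_mul]
  calc Rat.padicValuation p 2 * Rat.padicValuation p D₁ ≤ 1 * exp (-2) := by gcongr
    _ = exp (-2) := one_mul _

/-! ## The odd companion: `H_{p−1} ≡ −(1/3) p² B_{p−3} (mod p³)` -/

/-- `v_p(n) ≤ exp(−1)` for a natural number divisible by `p`. [folklore] -/
private theorem padicValuation_natCast_le_of_dvd {n : ℕ} (hn : p ∣ n) :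
    Rat.padicValuation p (n : ℚ) ≤ exp (-1) := by
  obtain ⟨c, rfl⟩ := hn
  push_cast
  rw [map_mul, Rat.padicValuation_self]
  calc exp (-1) * Rat.padicValuation p (c : ℚ) ≤ exp (-1) * 1 := by
        gcongr
        rw [← Int.cast_natCast, Rat.padicValuation_cast]; exact Int.padicValuation_le_one p c
    _ = exp (-1) := mul_one _

/-- `v_p(1/n) = 1` for `0 < n < p`. [folklore] -/
private theorem padicValuation_inv_natCast' {n : ℕ} (hn1 : 1 ≤ n) (hnp : n < p) :
    Rat.padicValuation p ((n : ℚ)⁻¹) = 1 := by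
  have h : ¬ p ∣ n := fun h ↦ by have := Nat.le_of_dvd (by omega) h; omega
  rw [map_inv₀, ← Int.cast_natCast, Rat.padicValuation_cast, Int.padicValuation_eq_one_iff.2
    (by exact_mod_cast h), inv_one]

/-- **The pairing**: for `0 < k < p`, `1/(k(p−k)) ≡ −(1/k² + p/k³) (mod p²)`; exactly
`1/(k(p−k)) + 1/k² + p/k³ = −p²/(k³(k−p))`. [cite: Mestrovic2011, eq. (20) (proof input)] -/
theorem padicValuation_pairing_le {k : ℕ} (hk1 : 1 ≤ k) (hkp : k < p) :
    Rat.padicValuation p (((k : ℚ) * ((p : ℚ) - k))⁻¹ + ((k : ℚ)⁻¹) ^ 2 + p * ((k : ℚ)⁻¹) ^ 3) ≤ exp (-2) := by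
  have hk0 : (k : ℚ) ≠ 0 := by exact_mod_cast (show k ≠ 0 by omega)
  have hpk : (p : ℚ) - k ≠ 0 := by
    have : (k : ℚ) < p := by exact_mod_cast hkp
    linarith
  have hkp' : (k : ℚ) - p ≠ 0 := fun h ↦ hpk (by linarith)
  have hid : ((k : ℚ) * ((p : ℚ) - k))⁻¹ + ((k : ℚ)⁻¹) ^ 2 + p * ((k : ℚ)⁻¹) ^ 3 =
      (p : ℚ) ^ 2 * (((k : ℚ)⁻¹) ^ 3 * (((p - k : ℕ) : ℚ))⁻¹) := by
    rw [Nat.cast_sub hkp.le]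
    field_simp
    ring
  rw [hid, map_mul, map_pow, Rat.padicValuation_self, map_mul, map_pow, padicValuation_inv_natCast' hk1 hkp,
    padicValuation_inv_natCast' (by omega) (by omega), one_pow, one_mul, mul_one, ← exp_nsmul]
  norm_num

/-- `v_p(1/k³ − k^{p−4}) ≤ exp(−1)` for `0 < k < p` (`p ≥ 5`): `k³·k^{p−4} = k^{p−1} ≡ 1`. [folklore] -/
private theorem padicValuation_inv_cube_sub_le (h4 : 4 ≤ p) {k : ℕ} (hk1 : 1 ≤ k) (hkp : k < p) :
    Rat.padicValuation p (((k : ℚ)⁻¹) ^ 3 - (k : ℚ) ^ (p - 4)) ≤ exp (-1) := by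
  have hpk : ¬ p ∣ k := fun h ↦ by have := Nat.le_of_dvd (by omega) h; omega
  have hk0 : (k : ℚ) ≠ 0 := by exact_mod_cast (show k ≠ 0 by omega)
  have hcop : IsCoprime (k : ℤ) (p : ℤ) :=
    Nat.isCoprime_iff_coprime.2 ((Nat.Prime.coprime_iff_not_dvd hp.out).2 hpk).symm
  obtain ⟨q, hq⟩ := (Int.ModEq.pow_card_sub_one_eq_one hp.out hcop).symm.dvd
  have hF : (k : ℚ) ^ (p - 1) = 1 + (p : ℚ) * q := by
    have h := congrArg (Int.cast (R := ℚ)) hq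
    push_cast at h
    linear_combination h
  have hsplit : (k : ℚ) ^ (p - 1) = (k : ℚ) ^ (p - 4) * (k : ℚ) ^ 3 := by
    rw [← pow_add]; congr 1; omega
  have hid : ((k : ℚ)⁻¹) ^ 3 - (k : ℚ) ^ (p - 4) = -(p : ℚ) * ((q : ℚ) * ((k : ℚ)⁻¹) ^ 3) := by
    have e : (k : ℚ) ^ (p - 4) = (1 + (p : ℚ) * q) * ((k : ℚ)⁻¹) ^ 3 := by
      rw [← hF, hsplit]; field_simp
    rw [e]; ring
  rw [hid, map_mul, Valuation.map_neg, Rat.padicValuation_self, map_mul, map_pow,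
    padicValuation_inv_natCast' hk1 hkp, one_pow, mul_one]
  calc exp (-1) * Rat.padicValuation p (q : ℚ) ≤ exp (-1) * 1 := by
        gcongr; rw [Rat.padicValuation_cast]; exact Int.padicValuation_le_one p q
    _ = exp (-1) := mul_one _

/-- `v_p(Σ_{0<k<p} k^{p−4}) ≤ exp(−1)` for `p ≥ 5` (`Σ_{x ∈ 𝔽_p} x^{p−4} = 0` as `0 < p − 4 < p − 1`). [folklore] -/
private theorem padicValuation_sum_pow_le (h5 : 5 ≤ p) :
    Rat.padicValuation p (∑ k ∈ Ico 1 p, (k : ℚ) ^ (p - 4)) ≤ exp (-1) := by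
  have hnat : (∑ k ∈ Ico 1 p, (k : ℚ) ^ (p - 4)) = ((∑ k ∈ Ico 1 p, k ^ (p - 4) : ℕ) : ℚ) := by push_cast; rfl
  rw [hnat]
  refine padicValuation_natCast_le_of_dvd ?_
  rw [← ZMod.natCast_eq_zero_iff, Nat.cast_sum]
  -- `Σ_{0<k<p} k^{p-4} = Σ_{x : ZMod p} x^{p-4}` (the term `x = 0` vanishes)
  have hzm : ∑ x : ZMod p, x ^ (p - 4) = ∑ m ∈ range p, ((m : ℕ) : ZMod p) ^ (p - 4) := by
    refine (Finset.sum_nbij' (fun m : ℕ ↦ (m : ZMod p)) (fun x : ZMod p ↦ x.val) ?_ ?_ ?_ ?_ ?_).symm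
    · intro m _; exact Finset.mem_univ _
    · intro x _; exact Finset.mem_range.mpr (ZMod.val_lt x)
    · intro m hm; exact ZMod.val_cast_of_lt (Finset.mem_range.mp hm)
    · intro x _; exact ZMod.natCast_zmod_val x
    · intro m _; rfl
  have h0 : ∑ m ∈ range p, ((m : ℕ) : ZMod p) ^ (p - 4) = ∑ m ∈ Ico 1 p, ((m : ℕ) : ZMod p) ^ (p - 4) := by
    rw [Finset.range_eq_Ico, Finset.sum_eq_sum_Ico_succ_bot hp.out.pos]
    simp; omega
  have h := FiniteField.sum_pow_lt_card_sub_one (ZMod p) (p - 4) (by rw [ZMod.card]; omega)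
  rw [hzm, h0] at h
  push_cast
  exact h

omit hp in
/-- Reflection: `Σ_{0<k<p} 1/(p−k) = Σ_{0<k<p} 1/k`. [folklore] -/
private theorem sum_Ico_inv_reflect :
    ∑ k ∈ Ico 1 p, (((p : ℚ) - k))⁻¹ = ∑ k ∈ Ico 1 p, ((k : ℚ))⁻¹ := by
  refine Finset.sum_nbij' (fun k ↦ p - k) (fun k ↦ p - k) ?_ ?_ ?_ ?_ ?_
  · intro k hk; rw [Finset.mem_Ico] at hk ⊢; omega
  · intro k hk; rw [Finset.mem_Ico] at hk ⊢; omega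
  · intro k hk; rw [Finset.mem_Ico] at hk; omega
  · intro k hk; rw [Finset.mem_Ico] at hk; omega
  · intro k hk
    rw [Finset.mem_Ico] at hk
    rw [Nat.cast_sub (by omega)]

/-- **Glaisher (1900): `Σ_{k=1}^{p−1} 1/k ≡ −(1/3) p² B_{p−3} (mod p³)` for every prime `p ≥ 5`**, i.e.
`v_p(H_{p−1} + (1/3) p² B_{p−3}) ≤ exp(−3)`. [cite: Mestrovic2011, eq. (20) at m = 1 (Glaisher 1900 [gl2])] -/
theorem padicValuation_harmonic_add_le (h5 : 5 ≤ p) :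
    Rat.padicValuation p (∑ k ∈ Ico 1 p, ((k : ℚ))⁻¹ + (1 / 3 : ℚ) * (p : ℚ) ^ 2 * bernoulli (p - 3)) ≤
      exp (-3) := by
  -- pieces
  set H : ℚ := ∑ k ∈ Ico 1 p, ((k : ℚ))⁻¹ with hH
  set S₂ : ℚ := ∑ k ∈ Ico 1 p, ((k : ℚ)⁻¹) ^ 2 with hS₂
  set S₃ : ℚ := ∑ k ∈ Ico 1 p, ((k : ℚ)⁻¹) ^ 3 with hS₃
  set P : ℚ := ∑ k ∈ Ico 1 p, ((k : ℚ) * ((p : ℚ) - k))⁻¹ with hP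
  set E : ℚ := ∑ k ∈ Ico 1 p, (((k : ℚ) * ((p : ℚ) - k))⁻¹ + ((k : ℚ)⁻¹) ^ 2 + p * ((k : ℚ)⁻¹) ^ 3) with hE
  set T : ℚ := ∑ k ∈ Ico 1 p, (k : ℚ) ^ (p - 4) with hT
  set G : ℚ := S₂ - (2 / 3 : ℚ) * p * bernoulli (p - 3) with hG
  -- `2H = p P` (pairing `1/k + 1/(p−k) = p/(k(p−k))`)
  have h2H : 2 * H = p * P := by
    have e : ∀ k ∈ Ico 1 p, (p : ℚ) * ((k : ℚ) * ((p : ℚ) - k))⁻¹ = ((k : ℚ))⁻¹ + (((p : ℚ) - k))⁻¹ := by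
      intro k hk
      rw [Finset.mem_Ico] at hk
      have hk0 : (k : ℚ) ≠ 0 := by exact_mod_cast (show k ≠ 0 by omega)
      have hpk : (p : ℚ) - k ≠ 0 := by
        have : (k : ℚ) < p := by exact_mod_cast hk.2
        linarith
      field_simp
      ring
    rw [hP, hH, Finset.mul_sum, Finset.mul_sum, Finset.sum_congr rfl e, Finset.sum_add_distrib,
      sum_Ico_inv_reflect, ← two_mul, Finset.mul_sum]
  -- `E = P + S₂ + p S₃`, `S₃ = (S₃ − T) + T`
  have hEeq : E = P + S₂ + p * S₃ := by
    rw [hE, Finset.sum_add_distrib, Finset.sum_add_distrib, hP, hS₂, hS₃, Finset.mul_sum]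
  have hEv : Rat.padicValuation p E ≤ exp (-2) :=
    Valuation.map_sum_le _ fun k hk ↦ by
      rw [Finset.mem_Ico] at hk
      exact padicValuation_pairing_le hk.1 hk.2
  have hS₃v : Rat.padicValuation p S₃ ≤ exp (-1) := by
    have e : S₃ = (∑ k ∈ Ico 1 p, (((k : ℚ)⁻¹) ^ 3 - (k : ℚ) ^ (p - 4))) + T := by
      rw [hS₃, hT, ← Finset.sum_add_distrib]
      exact Finset.sum_congr rfl fun k _ ↦ by ring
    rw [e]
    refine Valuation.map_add_le _ (Valuation.map_sum_le _ fun k hk ↦ ?_) (padicValuation_sum_pow_le h5)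
    rw [Finset.mem_Ico] at hk
    exact padicValuation_inv_cube_sub_le (by omega) hk.1 hk.2
  have hGv : Rat.padicValuation p G ≤ exp (-2) := padicValuation_sum_inv_sq_sub_le h5
  -- `2(H + p²B/3) = p E − p² S₃ − p G`
  have key : (2 : ℚ) * (H + (1 / 3 : ℚ) * (p : ℚ) ^ 2 * bernoulli (p - 3)) = p * E - (p : ℚ) ^ 2 * S₃ - p * G := by
    rw [hEeq, hG]; linear_combination h2H
  have hv2 : Rat.padicValuation p (2 : ℚ) = 1 := by
    rw [show (2 : ℚ) = ((2 : ℤ) : ℚ) by norm_num, Rat.padicValuation_cast, Int.padicValuation_eq_one_iff]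
    intro h
    have := Int.le_of_dvd (by norm_num) h
    have : (5 : ℤ) ≤ p := by exact_mod_cast h5
    omega
  have hp1 : Rat.padicValuation p (p : ℚ) = exp (-1) := Rat.padicValuation_self p
  have hmain : Rat.padicValuation p ((2 : ℚ) * (H + (1 / 3 : ℚ) * (p : ℚ) ^ 2 * bernoulli (p - 3))) ≤ exp (-3) := by
    rw [key]
    refine Valuation.map_sub_le _ (Valuation.map_sub_le _ ?_ ?_) ?_
    · rw [map_mul, hp1]
      calc exp (-1) * Rat.padicValuation p E ≤ exp (-1) * exp (-2) := by gcongr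
        _ = exp (-3) := by rw [← exp_add]; norm_num
    · rw [map_mul, map_pow, hp1, ← exp_nsmul]
      calc exp (2 • (-1 : ℤ)) * Rat.padicValuation p S₃ ≤ exp (2 • (-1 : ℤ)) * exp (-1) := by gcongr
        _ = exp (-3) := by rw [← exp_add]; norm_num
    · rw [map_mul, hp1]
      calc exp (-1) * Rat.padicValuation p G ≤ exp (-1) * exp (-2) := by gcongr
        _ = exp (-3) := by rw [← exp_add]; norm_num
  rwa [map_mul, hv2, one_mul] at hmain


/-! ## Appendix B (zeta5-irr lit seat, 2026-08-26). The Bernoulli forms of the Wolstenholme–Glaisher–Ljunggren congruences modulo `p⁴`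

With (21) (`padicValuation_harmonic_add_le`) the Bernoulli-free statements of
`LjunggrenBinomialCongruence.lean` — whose single scalar is `p·A_{p−2} = (p−1)!·p·H_{p−1}` — become the
printed ones: Glaisher's (13) `C(np−1, p−1) ≡ 1 − ⅓n(n−1)p³B_{p−3} (mod p⁴)` and (12), Helou–Terjanian's
(40) `C(np, mp)/C(n, m) ≡ 1 − ⅓mn(n−m)p³B_{p−3} (mod p⁴)` (Meštrović, arXiv:1111.3057, §2 (12)–(13),
§6 (40), held text chunks p0005/p0008), Zhao's remark to his Definition 3.1 «w_p ≡ −⅓B_{p−3} (mod p)»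
(`w_p ≡ H_{p−1}/p² (mod p²)`) and the second clause of his Theorem 3.2 «C(np, rp)/C(n, r) ≡ 1
(mod p⁴) for all n, r if and only if p divides the numerator of B_{p−3}» (J. Number Theory 123
(2007), held text `paper:arxiv-math_0303332` chunk p0004). Everything PROVED; no definition, no
named fact. Statements, as above, through `Rat.padicValuation p` (`v(x − y) ≤ exp(−k)` for
«`x ≡ y (mod p^k)`»). -/

open scoped Nat

/-- For an integer `z`: `v_p(z) ≤ exp(−k) ↔ p^k ∣ z`. [folklore] -/
private theorem padicValuation_intCast_le_exp_neg_iff (z : ℤ) (k : ℕ) :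
    Rat.padicValuation p (z : ℚ) ≤ exp (-(k : ℤ)) ↔ (p : ℤ) ^ k ∣ z := by
  rw [padicValInt_dvd_iff]
  by_cases hz : z = 0
  · subst hz; simp
  · simp only [Rat.padicValuation, Valuation.coe_mk, MonoidWithZeroHom.coe_mk, ZeroHom.coe_mk,
      Rat.intCast_eq_zero_iff, hz, if_false, padicValRat.of_int, exp_le_exp, neg_le_neg_iff,
      Nat.cast_le, false_or]

/-- `0 < i < p` is a `p`-adic unit. [folklore] -/
private theorem padicValuation_natCast_eq_one_of_lt {i : ℕ} (hi0 : 0 < i) (hip : i < p) :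
    Rat.padicValuation p (i : ℚ) = 1 :=
  padicValuation_natCast_eq_one fun h ↦ absurd (Nat.le_of_dvd hi0 h) (by omega)

/-- `v_p(p^e) = exp(−e)`. [folklore] -/
private theorem padicValuation_prime_pow (e : ℕ) :
    Rat.padicValuation p ((p : ℚ) ^ e) = exp (-(e : ℤ)) := by
  rw [map_pow, Rat.padicValuation_self, ← exp_nsmul, smul_neg, nsmul_eq_mul, mul_one]

/-- Cancellation of a power of `p`: `exp(a)·x ≤ exp(a+b) ⇒ x ≤ exp(b)` in `ℤᵐ⁰`. [folklore] -/
private theorem le_exp_of_mul_le {x : ℤᵐ⁰} {a b : ℤ} (h : exp a * x ≤ exp (a + b)) : x ≤ exp b := by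
  by_cases hx : x = 0
  · rw [hx]; exact zero_le
  · rw [← exp_log hx] at h ⊢
    rw [← exp_add, exp_le_exp] at h
    rw [exp_le_exp]; omega

omit hp in
/-- `[1, p−1] = [1, p)` as finsets. [folklore] -/
private theorem sum_Icc_one_div_eq :
    ∑ i ∈ Icc 1 (p - 1), (1 : ℚ) / (i : ℚ) = ∑ k ∈ Ico 1 p, ((k : ℚ))⁻¹ := by
  have h : Icc 1 (p - 1) = Ico 1 p := by
    ext i; simp only [Finset.mem_Icc, Finset.mem_Ico]; omega
  rw [h]
  exact Finset.sum_congr rfl fun i _ ↦ one_div _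

/-- (21) in the shape used below: `v_p(Σ_{0<i<p} 1/i + p²B_{p−3}/3) ≤ exp(−3)`.
[cite: Mestrovic2011, §4 (21)] -/
private theorem padicValuation_harmonic_add_le' (h5 : 5 ≤ p) :
    Rat.padicValuation p ((∑ i ∈ Icc 1 (p - 1), (1 : ℚ) / (i : ℚ)) +
      (p : ℚ) ^ 2 * bernoulli (p - 3) / 3) ≤ exp (-3) := by
  have h := padicValuation_harmonic_add_le h5
  have e : (∑ i ∈ Icc 1 (p - 1), (1 : ℚ) / (i : ℚ)) + (p : ℚ) ^ 2 * bernoulli (p - 3) / 3 =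
      ∑ k ∈ Ico 1 p, ((k : ℚ))⁻¹ + (1 / 3 : ℚ) * (p : ℚ) ^ 2 * bernoulli (p - 3) := by
    rw [sum_Icc_one_div_eq]; ring
  rw [e]; exact h

/-- `A_{p−2} = Σ_{0<i<p} (p−1)!/i = (p−1)!·H_{p−1}` as rationals. [folklore] -/
private theorem natCast_sum_factorial_div (p : ℕ) :
    ((∑ i ∈ Icc 1 (p - 1), (p - 1)! / i : ℕ) : ℚ) =
      (((p - 1)! : ℕ) : ℚ) * ∑ i ∈ Icc 1 (p - 1), (1 : ℚ) / (i : ℚ) := by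
  rw [Nat.cast_sum, Finset.mul_sum]
  refine Finset.sum_congr rfl fun i hi ↦ ?_
  rw [Finset.mem_Icc] at hi
  rw [Nat.cast_div (Nat.dvd_factorial (by omega) hi.2) (by exact_mod_cast (show i ≠ 0 by omega)),
    mul_one_div]

omit hp in
/-- `A_{p−2} = (p−1)!·Σ_{0<i<p} i⁻¹` in `ℤ/p^k` (each `i` a unit). [folklore] -/
private theorem natCast_sum_factorial_div_zmod (hP : p.Prime) (k : ℕ) :
    ((∑ i ∈ Icc 1 (p - 1), (p - 1)! / i : ℕ) : ZMod (p ^ k)) =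
      (((p - 1)! : ℕ) : ZMod (p ^ k)) * ∑ i ∈ Icc 1 (p - 1), (i : ZMod (p ^ k))⁻¹ := by
  rw [Nat.cast_sum, Finset.mul_sum]
  refine Finset.sum_congr rfl fun i hi ↦ ?_
  have hi' := Finset.mem_Icc.1 hi
  have hcopi : Nat.Coprime i (p ^ k) := by
    refine Nat.Coprime.pow_right k (Nat.coprime_comm.1 ((Nat.Prime.coprime_iff_not_dvd hP).2 ?_))
    intro h; have := Nat.le_of_dvd (by omega) h; omega
  have hdiv : (p - 1)! / i * i = (p - 1)! := Nat.div_mul_cancel (Nat.dvd_factorial (by omega) hi'.2)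
  have hcast := congrArg (fun m : ℕ ↦ (m : ZMod (p ^ k))) hdiv
  simp only [Nat.cast_mul] at hcast
  rw [← hcast, mul_assoc, ZMod.coe_mul_inv_eq_one i hcopi, mul_one]

/-- `(p−1)!` is a `p`-adic unit. [folklore] -/
private theorem padicValuation_factorial_eq_one :
    Rat.padicValuation p (((p - 1)! : ℕ) : ℚ) = 1 := by
  rw [← Int.cast_natCast, Rat.padicValuation_cast, Int.padicValuation_eq_one_iff,
    Int.natCast_dvd_natCast, Nat.Prime.dvd_factorial hp.out]
  have := hp.out.one_lt
  omega

/-- **Glaisher's congruence (1900) as printed, Meštrović (13)**: for every prime `p ≥ 5` and `n ≥ 1`,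
`C(np − 1, p − 1) ≡ 1 − ⅓n(n−1)p³B_{p−3} (mod p⁴)`, i.e.
`v_p(C(np−1, p−1) − (1 − ⅓n(n−1)p³B_{p−3})) ≤ exp(−4)` («J.W.L. Glaisher ([gl1], [gl2]) proved that
for any positive integer n ≥ 1 and any prime p ≥ 5 C(np−1, p−1) ≡ 1 − ⅓n(n−1)p³B_{p−3} (mod p⁴)»):
the tree's Bernoulli-free `(p−1)!·C(np−1,p−1) ≡ (p−1)! + (n−1)n·p·A_{p−2} (mod p⁴)`
(`Ljunggren.factorial_mul_choose_mul_prime_sub_one_modEq_pow_four`) with `p·H_{p−1} ≡ −⅓p³B_{p−3}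
(mod p⁴)` from (21). [cite: Mestrovic2011, §2 (13) (Glaisher 1900)] -/
theorem padicValuation_choose_mul_prime_sub_one_sub_le (hp5 : 5 ≤ p) {n : ℕ} (hn : 1 ≤ n) :
    Rat.padicValuation p ((((n * p - 1).choose (p - 1) : ℕ) : ℚ) -
      (1 - (n : ℚ) * ((n : ℚ) - 1) / 3 * (p : ℚ) ^ 3 * bernoulli (p - 3))) ≤ exp (-4) := by
  have hP := hp.out
  set F : ℚ := (((p - 1)! : ℕ) : ℚ) with hF
  set H : ℚ := ∑ i ∈ Icc 1 (p - 1), (1 : ℚ) / (i : ℚ) with hH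
  set C : ℚ := (((n * p - 1).choose (p - 1) : ℕ) : ℚ) with hC
  have hAq : ((∑ i ∈ Icc 1 (p - 1), (p - 1)! / i : ℕ) : ℚ) = F * H := natCast_sum_factorial_div p
  set A : ℕ := ∑ i ∈ Icc 1 (p - 1), (p - 1)! / i with hAdef
  have hFv : Rat.padicValuation p F = 1 := padicValuation_factorial_eq_one
  -- the tree's congruence `(p−1)!·C ≡ (p−1)! + (n−1)n p A (mod p⁴)`, as a valuation in `ℚ`
  have h4 := Ljunggren.factorial_mul_choose_mul_prime_sub_one_modEq_pow_four
    hP (by omega) hn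
  rw [← hAdef] at h4
  have hv : Rat.padicValuation p (F * (1 + ((n : ℚ) - 1) * n * p * H - C)) ≤ exp (-4) := by
    have hd := Int.modEq_iff_dvd.1 h4
    have hv0 := (padicValuation_intCast_le_exp_neg_iff (p := p) _ 4).2 hd
    have hcast : ((((((p - 1)! : ℕ) : ℤ) + ((n : ℤ) - 1) * n * p * (A : ℤ) -
        (((p - 1)! : ℕ) : ℤ) * ((n * p - 1).choose (p - 1) : ℕ) : ℤ)) : ℚ) =
        F * (1 + ((n : ℚ) - 1) * n * p * H - C) := by
      push_cast
      rw [hAq]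
      ring
    rw [hcast] at hv0
    simpa using hv0
  rw [map_mul, hFv, one_mul] at hv
  have hG1 := padicValuation_harmonic_add_le' hp5
  have hid : C - (1 - (n : ℚ) * ((n : ℚ) - 1) / 3 * (p : ℚ) ^ 3 * bernoulli (p - 3)) =
      -(1 + ((n : ℚ) - 1) * n * p * H - C) +
        ((n : ℚ) - 1) * n * p * (H + (p : ℚ) ^ 2 * bernoulli (p - 3) / 3) := by
    ring
  rw [hid]
  refine Valuation.map_add_le _ (by rwa [Valuation.map_neg]) ?_
  have hn1 : Rat.padicValuation p ((n : ℚ) - 1) ≤ 1 := by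
    have := padicValuation_intCast_le_one (p := p) ((n : ℤ) - 1)
    push_cast at this
    exact this
  rw [map_mul, map_mul, map_mul, Rat.padicValuation_self]
  calc Rat.padicValuation p ((n : ℚ) - 1) * Rat.padicValuation p (n : ℚ) * exp (-1) *
        Rat.padicValuation p (H + (p : ℚ) ^ 2 * bernoulli (p - 3) / 3)
      ≤ 1 * 1 * exp (-1) * exp (-3) :=
        mul_le_mul' (mul_le_mul' (mul_le_mul' hn1 (padicValuation_natCast_le_one n)) le_rfl) hG1
    _ = exp (-4) := by rw [one_mul, one_mul, ← exp_add]; norm_num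

/-- **Meštrović (12)** (Glaisher's (5) in Bernoulli form): for every prime `p ≥ 5`,
`C(2p − 1, p − 1) ≡ 1 − ⅔p³B_{p−3} (mod p⁴)` (printed there «for all primes p ≥ 7»; it holds for
`p = 5` as well, both sides being what (13) gives at `n = 2`).
[cite: Mestrovic2011, §2 (12)] -/
theorem padicValuation_choose_two_mul_sub_le (hp5 : 5 ≤ p) :
    Rat.padicValuation p ((((2 * p - 1).choose (p - 1) : ℕ) : ℚ) -
      (1 - 2 / 3 * (p : ℚ) ^ 3 * bernoulli (p - 3))) ≤ exp (-4) := by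
  have h := padicValuation_choose_mul_prime_sub_one_sub_le hp5 (n := 2) (by norm_num)
  have e : (1 : ℚ) - 2 / 3 * (p : ℚ) ^ 3 * bernoulli (p - 3) =
      1 - ((2 : ℕ) : ℚ) * (((2 : ℕ) : ℚ) - 1) / 3 * (p : ℚ) ^ 3 * bernoulli (p - 3) := by norm_num
  rw [e]; exact h

/-- **Helou–Terjanian's congruence as printed, Meštrović (40)**: for every prime `p ≥ 5` and all
`a, b ∈ ℕ`, `C(ap, bp) ≡ C(a, b)·(1 − ⅓ab(a−b)p³B_{p−3}) (mod p⁴)`, i.e.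
`v_p(C(ap,bp) − C(a,b)(1 − ⅓ab(a−b)p³B_{p−3})) ≤ exp(−4)` («As an application of (39), it can be
obtained [ht] that for each prime p ≥ 5 C(np, mp)/C(n, m) ≡ 1 − ⅓mn(n−m)p³B_{p−3} (mod p⁴) (40)»;
printed for `n ≥ m`; for `b > a` both binomial coefficients vanish): the tree's Bernoulli-free form
`C(ap,bp) = C(a,b)(1 + ab(a−b)·p·Σi⁻¹)` in `ℤ/p⁴` (`Ljunggren.choose_mul_prime_eq_pow_four`), cleared of
inverses by `(p−1)!`, with (21). [cite: Mestrovic2011, §6 (40) and Remark 19 (Helou–Terjanian,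
J. Number Theory 128 (2008))] -/
theorem padicValuation_choose_mul_prime_sub_le (hp5 : 5 ≤ p) (a b : ℕ) :
    Rat.padicValuation p ((((a * p).choose (b * p) : ℕ) : ℚ) -
      (a.choose b : ℕ) * (1 - (a : ℚ) * b * ((a : ℚ) - b) / 3 * (p : ℚ) ^ 3 * bernoulli (p - 3)))
        ≤ exp (-4) := by
  have hP := hp.out
  rcases Nat.lt_or_ge a b with hab | hab
  · rw [Nat.choose_eq_zero_of_lt hab, Nat.choose_eq_zero_of_lt (mul_lt_mul_of_pos_right hab hP.pos)]
    simp
  haveI : NeZero (p ^ 4) := ⟨pow_ne_zero 4 hP.ne_zero⟩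
  set F : ℚ := (((p - 1)! : ℕ) : ℚ) with hF
  set H : ℚ := ∑ i ∈ Icc 1 (p - 1), (1 : ℚ) / (i : ℚ) with hH
  set C1 : ℚ := (((a * p).choose (b * p) : ℕ) : ℚ) with hC1
  set C0 : ℚ := ((a.choose b : ℕ) : ℚ) with hC0
  have hAq : ((∑ i ∈ Icc 1 (p - 1), (p - 1)! / i : ℕ) : ℚ) = F * H := natCast_sum_factorial_div p
  have hA : ((∑ i ∈ Icc 1 (p - 1), (p - 1)! / i : ℕ) : ZMod (p ^ 4)) =
      (((p - 1)! : ℕ) : ZMod (p ^ 4)) * ∑ i ∈ Icc 1 (p - 1), (i : ZMod (p ^ 4))⁻¹ :=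
    natCast_sum_factorial_div_zmod hP 4
  set A : ℕ := ∑ i ∈ Icc 1 (p - 1), (p - 1)! / i with hAdef
  have hFv : Rat.padicValuation p F = 1 := padicValuation_factorial_eq_one
  -- the tree's `ℤ/p⁴` identity, cleared of the inverses: an integer divisible by `p⁴`
  have hZ := Ljunggren.choose_mul_prime_eq_pow_four hP (by omega) a b
  rw [Nat.cast_sub hab] at hZ
  set X : ℤ := (((p - 1)! : ℕ) : ℤ) * ((a * p).choose (b * p) : ℕ) -
    (a.choose b : ℕ) * ((((p - 1)! : ℕ) : ℤ) + (a : ℤ) * b * ((a : ℤ) - b) * p * (A : ℤ)) with hX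
  have hX0 : ((X : ℤ) : ZMod (p ^ 4)) = 0 := by
    rw [hX]; push_cast; rw [hZ, hA]; ring
  have hdvd : (p : ℤ) ^ 4 ∣ X := by
    have := (ZMod.intCast_zmod_eq_zero_iff_dvd X (p ^ 4)).1 hX0
    push_cast at this
    exact this
  have hv : Rat.padicValuation p (F * (C1 - C0 * (1 + (a : ℚ) * b * ((a : ℚ) - b) * p * H)))
      ≤ exp (-4) := by
    have hv0 := (padicValuation_intCast_le_exp_neg_iff (p := p) X 4).2 hdvd
    have hcast : ((X : ℤ) : ℚ) = F * (C1 - C0 * (1 + (a : ℚ) * b * ((a : ℚ) - b) * p * H)) := by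
      rw [hX]; push_cast; rw [hAq]; ring
    rw [hcast] at hv0
    simpa using hv0
  rw [map_mul, hFv, one_mul] at hv
  have hG1 := padicValuation_harmonic_add_le' hp5
  have hid : C1 - C0 * (1 - (a : ℚ) * b * ((a : ℚ) - b) / 3 * (p : ℚ) ^ 3 * bernoulli (p - 3)) =
      (C1 - C0 * (1 + (a : ℚ) * b * ((a : ℚ) - b) * p * H)) +
        C0 * ((a : ℚ) * b * ((a : ℚ) - b)) * p * (H + (p : ℚ) ^ 2 * bernoulli (p - 3) / 3) := by
    ring
  rw [hid]
  refine Valuation.map_add_le _ hv ?_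
  have hab1 : Rat.padicValuation p ((a : ℚ) * b * ((a : ℚ) - b)) ≤ 1 := by
    have := padicValuation_intCast_le_one (p := p) ((a : ℤ) * b * ((a : ℤ) - b))
    push_cast at this
    exact this
  rw [map_mul, map_mul, map_mul, Rat.padicValuation_self]
  calc Rat.padicValuation p C0 * Rat.padicValuation p ((a : ℚ) * b * ((a : ℚ) - b)) * exp (-1) *
        Rat.padicValuation p (H + (p : ℚ) ^ 2 * bernoulli (p - 3) / 3)
      ≤ 1 * 1 * exp (-1) * exp (-3) :=
        mul_le_mul' (mul_le_mul' (mul_le_mul' (padicValuation_natCast_le_one _) hab1) le_rfl) hG1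
    _ = exp (-4) := by rw [one_mul, one_mul, ← exp_add]; norm_num

/-- **Zhao's remark (Gl) to Definition 3.1: `w_p ≡ −⅓B_{p−3} (mod p)`** — for every prime `p ≥ 5`
and every integer `w` with `p²w ≡ H_{p−1} (mod p⁴)`, stated without denominators as
`(p−1)!·p²·w ≡ A_{p−2} (mod p⁴)` (`A_{p−2} = Σ_{0<i<p}(p−1)!/i = (p−1)!H_{p−1}`; Zhao's `w_p`, «the
unique non-negative integer w_p < p² such that w_p ≡ H₁(p−1)/p² (mod p²)», is such a `w`, and this is
the hypothesis of `Ljunggren.choose_mul_prime_modEq_pow_five_of_wp`): `v_p(w + B_{p−3}/3) ≤ exp(−1)`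
(«It is a well-known fact that (see for eg. [Gl]) w_p ≡ −⅓B_{p−3} (mod p)»).
[cite: Zhao2007, Definition 3.1 and (Gl)] [cite: Mestrovic2011, §4 (21)] -/
theorem padicValuation_wp_add_le (hp5 : 5 ≤ p) {w : ℤ}
    (hw : (((p - 1)! : ℕ) : ℤ) * (p : ℤ) ^ 2 * w ≡ ((∑ i ∈ Icc 1 (p - 1), (p - 1)! / i : ℕ) : ℤ)
      [ZMOD (p : ℤ) ^ 4]) :
    Rat.padicValuation p ((w : ℚ) + bernoulli (p - 3) / 3) ≤ exp (-1) := by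
  have hP := hp.out
  set F : ℚ := (((p - 1)! : ℕ) : ℚ) with hF
  set H : ℚ := ∑ i ∈ Icc 1 (p - 1), (1 : ℚ) / (i : ℚ) with hH
  have hAq : ((∑ i ∈ Icc 1 (p - 1), (p - 1)! / i : ℕ) : ℚ) = F * H := natCast_sum_factorial_div p
  set A : ℕ := ∑ i ∈ Icc 1 (p - 1), (p - 1)! / i with hAdef
  have hFv : Rat.padicValuation p F = 1 := padicValuation_factorial_eq_one
  have hv : Rat.padicValuation p (F * (H - (p : ℚ) ^ 2 * w)) ≤ exp (-4) := by
    have hd := Int.modEq_iff_dvd.1 hw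
    have hv0 := (padicValuation_intCast_le_exp_neg_iff (p := p) _ 4).2 hd
    have hcast : ((((A : ℤ) - (((p - 1)! : ℕ) : ℤ) * (p : ℤ) ^ 2 * w : ℤ)) : ℚ) =
        F * (H - (p : ℚ) ^ 2 * w) := by
      push_cast; rw [hAq]; ring
    rw [hcast] at hv0
    simpa using hv0
  rw [map_mul, hFv, one_mul] at hv
  have hG1 := padicValuation_harmonic_add_le' hp5
  have hid : (p : ℚ) ^ 2 * ((w : ℚ) + bernoulli (p - 3) / 3) =
      (H + (p : ℚ) ^ 2 * bernoulli (p - 3) / 3) - (H - (p : ℚ) ^ 2 * w) := by ring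
  have h3 : Rat.padicValuation p ((p : ℚ) ^ 2 * ((w : ℚ) + bernoulli (p - 3) / 3)) ≤ exp (-3) := by
    rw [hid]
    exact Valuation.map_sub_le _ hG1 (hv.trans (by rw [exp_le_exp]; norm_num))
  rw [map_mul, padicValuation_prime_pow] at h3
  exact le_exp_of_mul_le (a := -2) (b := -1) (by simpa using h3)

/-- `p` divides the numerator of `B_{p−3}` iff `v_p(B_{p−3}) ≤ exp(−1)` (`p ∤ den B_{p−3}` by
von Staudt–Clausen, `p − 1 ∤ p − 3`). [folklore] -/
private theorem dvd_num_bernoulli_iff (hp5 : 5 ≤ p) :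
    (p : ℤ) ∣ (bernoulli (p - 3)).num ↔ Rat.padicValuation p (bernoulli (p - 3)) ≤ exp (-1) := by
  have hP := hp.out
  have hpm : ¬ (p - 1) ∣ (p - 3) := by
    intro h; have := Nat.le_of_dvd (by omega) h; omega
  have hden := KummerCongruence.not_dvd_den_bernoulli (p := p) hpm
  have hdenv : Rat.padicValuation p (((bernoulli (p - 3)).den : ℤ) : ℚ) = 1 := by
    rw [Rat.padicValuation_cast, Int.padicValuation_eq_one_iff, Int.natCast_dvd_natCast]
    exact hden
  have hB : Rat.padicValuation p (bernoulli (p - 3)) =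
      Rat.padicValuation p (((bernoulli (p - 3)).num : ℤ) : ℚ) := by
    conv_lhs => rw [← Rat.num_div_den (bernoulli (p - 3))]
    rw [map_div₀, ← Int.cast_natCast, hdenv, div_one]
  rw [hB]
  have := padicValuation_intCast_le_exp_neg_iff (p := p) (bernoulli (p - 3)).num 1
  simp only [Nat.cast_one, pow_one] at this
  exact this.symm

/-- **Zhao's Theorem 3.2, second clause**: for every prime `p ≥ 5`, `C(ap, bp) ≡ C(a, b) (mod p⁴)`
for ALL `a, b ∈ ℕ` if and only if `p` divides the numerator of `B_{p−3}` («Moreover,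
C(np, rp)/C(n, r) ≡ 1 (mod p⁴) for all n, r if and only if p divides the numerator of B_{p−3}»;
stated here as the congruence of the binomial coefficients themselves, `v_p(C(ap,bp) − C(a,b)) ≤
exp(−4)`, which for `b ≤ a` — `C(a,b)` need not be a unit — is what (40) controls; Zhao prints the
clause inside his `p ≥ 7` theorem, it holds for `p = 5` too). `⇐`: (40); `⇒`: `a = 2`, `b = 1` and
(12) force `v_p((4/3)p³B_{p−3}) ≤ exp(−4)`. [cite: Zhao2007, Theorem 3.2 (second clause) and (Gl)]
[cite: Mestrovic2011, §6 (40)] -/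
theorem forall_padicValuation_choose_mul_prime_sub_le_iff (hp5 : 5 ≤ p) :
    (∀ a b : ℕ, Rat.padicValuation p
        ((((a * p).choose (b * p) : ℕ) : ℚ) - (a.choose b : ℕ)) ≤ exp (-4)) ↔
      (p : ℤ) ∣ (bernoulli (p - 3)).num := by
  have hP := hp.out
  rw [dvd_num_bernoulli_iff hp5]
  have h3v : Rat.padicValuation p (3 : ℚ) = 1 := by
    have := padicValuation_natCast_eq_one_of_lt (p := p) (i := 3) (by norm_num) (by omega)
    simpa using this
  have h4v : Rat.padicValuation p (4 : ℚ) = 1 := by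
    have := padicValuation_natCast_eq_one_of_lt (p := p) (i := 4) (by norm_num) (by omega)
    simpa using this
  constructor
  · intro h
    have h21 := h 2 1
    have h40 := padicValuation_choose_mul_prime_sub_le hp5 2 1
    rw [one_mul, show Nat.choose 2 1 = 2 from rfl] at h21 h40
    push_cast at h21 h40
    have hid : (4 : ℚ) / 3 * (p : ℚ) ^ 3 * bernoulli (p - 3) =
        ((((2 * p).choose p : ℕ) : ℚ) - 2 * (1 - 2 * 1 * (2 - 1) / 3 * (p : ℚ) ^ 3 *
            bernoulli (p - 3))) - ((((2 * p).choose p : ℕ) : ℚ) - 2) := by ring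
    have hv : Rat.padicValuation p ((4 : ℚ) / 3 * (p : ℚ) ^ 3 * bernoulli (p - 3)) ≤ exp (-4) := by
      rw [hid]; exact Valuation.map_sub_le _ h40 h21
    rw [map_mul, map_mul, map_div₀, h4v, h3v, div_one, one_mul, padicValuation_prime_pow] at hv
    exact le_exp_of_mul_le (a := -3) (b := -1) (by simpa using hv)
  · intro hB a b
    have h40 := padicValuation_choose_mul_prime_sub_le hp5 a b
    have hid : (((a * p).choose (b * p) : ℕ) : ℚ) - (a.choose b : ℕ) =
        ((((a * p).choose (b * p) : ℕ) : ℚ) -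
          (a.choose b : ℕ) * (1 - (a : ℚ) * b * ((a : ℚ) - b) / 3 * (p : ℚ) ^ 3 * bernoulli (p - 3)))
        - (a.choose b : ℕ) * ((a : ℚ) * b * ((a : ℚ) - b)) / 3 * (p : ℚ) ^ 3 * bernoulli (p - 3) := by
      ring
    rw [hid]
    refine Valuation.map_sub_le _ h40 ?_
    have hab1 : Rat.padicValuation p ((a : ℚ) * b * ((a : ℚ) - b)) ≤ 1 := by
      have := padicValuation_intCast_le_one (p := p) ((a : ℤ) * b * ((a : ℤ) - b))
      push_cast at this
      exact this
    rw [map_mul, map_mul, map_div₀, map_mul, h3v, div_one, padicValuation_prime_pow]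
    calc Rat.padicValuation p ((a.choose b : ℕ) : ℚ) *
          Rat.padicValuation p ((a : ℚ) * b * ((a : ℚ) - b)) * exp (-((3 : ℕ) : ℤ)) *
          Rat.padicValuation p (bernoulli (p - 3))
        ≤ 1 * 1 * exp (-3) * exp (-1) :=
          mul_le_mul' (mul_le_mul' (mul_le_mul' (padicValuation_natCast_le_one _) hab1)
            (by norm_num)) hB
      _ = exp (-4) := by rw [one_mul, one_mul, ← exp_add]; norm_num

/-! ## Appendix C (zeta5-irr lit seat, g8): Glaisher's (20) for EVERY EVEN exponent
`Σ_{k=1}^{p−1} 1/k^m ≡ (m/(m+1)) p B_{p−1−m} (mod p²)` (`m` even, `p ≥ m + 3`)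

[Mestrovic2011, (20)] VERBATIM (p. 6): «In 1900 J.W.L. Glaisher ([gl2]; also see [gl3]) proved the following
generalizations of the congruences (18) and (19) (also see [s1]): if `m` is a positive integer and `p` a prime such
that `p ≥ m+3`, then `Σ_{k=1}^{p−1} 1/k^m ≡ (m/(m+1)) p B_{p−1−m} (mod p²)` if `m` is even,
`≡ −(m(m+1)/(2(m+2))) p² B_{p−2−m} (mod p³)` if `m` is odd.»  This appendix proves the EVEN half for every
even `m ≥ 2` (the case `m = 2` is `padicValuation_sum_inv_sq_sub_le` above, whose proof is followed line by line
with `3 ↦ m+1`, `4/3 ↦ (m+2)/(m+1)`, `p−3 ↦ p−1−m`, `2p−4 ↦ 2p−2−m`):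
termwise `1/k^m ≡ k^{p−1−m}(2 − k^{p−1}) (mod p²)` (Fermat quotient), `Σ = 2S_{p−1−m}(p) − S_{2p−2−m}(p)`,
Voronoi `S_j(p) ≡ pB_j (mod p²)` (even `j ≥ 2`), and the Kummer/Adams step
`pB_{2p−2−m} ≡ ((m+2)/(m+1)) pB_{p−1−m} (mod p²)` (`(2p−2−m)/(p−1−m) ≡ (m+2)/(m+1) (mod p)`).
The ODD half for `m ≥ 3` (`padicValuation_sum_inv_pow_add_le_of_odd`; the case `m = 1` is
`padicValuation_harmonic_add_le`) follows Glaisher's pairing `k ↔ p − k` to second order: for odd `m`,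
`1/(p−k)^m = −k^{−m}(1 − p/k)^{−m} ≡ −k^{−m}(1 + m p/k + C(m+1,2) p²/k²) (mod p³)` (the remainder is
`(p/k)³ ×` a `p`-integer, by `(1−x)^m = 1 − mx + C(m,2)x² − x³s` with `s` `p`-integral), whence
`2 Σ k^{−m} ≡ −m p Σ k^{−m−1} − C(m+1,2) p² Σ k^{−m−2} (mod p³)`, and the even half at `m + 1` plus
`Σ k^{−m−2} ≡ 0 (mod p)` (Theorem 119) give `Σ k^{−m} ≡ −(m(m+1)/(2(m+2))) p² B_{p−2−m} (mod p³)`. -/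

/-- For `0 < k < p` and `1 ≤ m ≤ p − 2`: `v_p(1/k^m − k^{p−1−m}(2 − k^{p−1})) ≤ exp(−2)` — the difference is
`p²q²/k^m` with `k^{p−1} = 1 + pq` (Fermat). [cite: Mestrovic2011, eq. (20) (proof input, Fermat quotient)] -/
theorem padicValuation_inv_pow_sub_le {m : ℕ} (hm1 : 1 ≤ m) (hmp : m + 2 ≤ p) {k : ℕ} (hk1 : 1 ≤ k)
    (hkp : k < p) :
    Rat.padicValuation p (((k : ℚ)⁻¹) ^ m - (k : ℚ) ^ (p - 1 - m) * (2 - (k : ℚ) ^ (p - 1))) ≤ exp (-2) := by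
  have hpk : ¬ p ∣ k := fun h ↦ by have := Nat.le_of_dvd (by omega) h; omega
  have hk0 : (k : ℚ) ≠ 0 := by exact_mod_cast (show k ≠ 0 by omega)
  -- Fermat: `k^{p−1} = 1 + p q`
  have hcop : IsCoprime (k : ℤ) (p : ℤ) :=
    Nat.isCoprime_iff_coprime.2 ((Nat.Prime.coprime_iff_not_dvd hp.out).2 hpk).symm
  obtain ⟨q, hq⟩ := (Int.ModEq.pow_card_sub_one_eq_one hp.out hcop).symm.dvd
  have hF : (k : ℚ) ^ (p - 1) = 1 + (p : ℚ) * q := by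
    have h := congrArg (Int.cast (R := ℚ)) hq
    push_cast at h
    linear_combination h
  -- the exact identity
  set a : ℚ := (k : ℚ) ^ (p - 1 - m) with ha
  have hsplit : (k : ℚ) ^ (p - 1) = a * (k : ℚ) ^ m := by
    rw [ha, ← pow_add]; congr 1; omega
  have hid : ((k : ℚ)⁻¹) ^ m - a * (2 - (k : ℚ) ^ (p - 1)) = (p : ℚ) ^ 2 * ((q : ℚ) ^ 2 * ((k : ℚ)⁻¹) ^ m) := by
    have h1 : ((k : ℚ)⁻¹) ^ m - a * (2 - a * (k : ℚ) ^ m) = (1 - a * (k : ℚ) ^ m) ^ 2 * ((k : ℚ)⁻¹) ^ m := by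
      have hkm : (k : ℚ) ^ m * ((k : ℚ)⁻¹) ^ m = 1 := by rw [← mul_pow, mul_inv_cancel₀ hk0, one_pow]
      linear_combination (a * (2 - a * (k : ℚ) ^ m)) * hkm
    have h2 : 1 - a * (k : ℚ) ^ m = -((p : ℚ) * q) := by rw [← hsplit, hF]; ring
    rw [hsplit, h1, h2]
    ring
  rw [hid, map_mul, padicValuation_prime_sq, map_mul, map_pow, map_pow, padicValuation_inv_natCast hpk, one_pow,
    mul_one]
  have hq1 := padicValuation_intCast_le_one (p := p) q
  have hq2 : Rat.padicValuation p (q : ℚ) ^ 2 ≤ 1 := by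
    calc Rat.padicValuation p (q : ℚ) ^ 2 ≤ 1 ^ 2 := by gcongr
      _ = 1 := one_pow 2
  calc exp (-2) * Rat.padicValuation p (q : ℚ) ^ 2 ≤ exp (-2) * 1 := by gcongr
    _ = exp (-2) := mul_one _

omit hp in
/-- `Σ_{0<k<p} k^{p−1−m}(2 − k^{p−1}) = 2 S_{p−1−m}(p) − S_{2p−2−m}(p)` with `S_j(p) = Σ_{t<p} t^j` (`m + 2 ≤ p`).
[folklore] -/
private theorem sum_Ico_pow_mul_eq_gen {m : ℕ} (hmp : m + 2 ≤ p) :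
    ∑ k ∈ Ico 1 p, (k : ℚ) ^ (p - 1 - m) * (2 - (k : ℚ) ^ (p - 1)) =
      2 * ∑ t ∈ range p, (t : ℚ) ^ (p - 1 - m) - ∑ t ∈ range p, (t : ℚ) ^ (2 * p - 2 - m) := by
  have h0 : ∀ f : ℕ → ℚ, f 0 = 0 → ∑ t ∈ range p, f t = ∑ t ∈ Ico 1 p, f t := by
    intro f hf
    rw [Finset.range_eq_Ico, Finset.sum_eq_sum_Ico_succ_bot (by omega), hf, zero_add]
  rw [h0 (fun t => (t : ℚ) ^ (p - 1 - m)) (by simp; omega),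
    h0 (fun t => (t : ℚ) ^ (2 * p - 2 - m)) (by simp; omega), Finset.mul_sum, ← Finset.sum_sub_distrib]
  refine Finset.sum_congr rfl fun k _ ↦ ?_
  have e : (k : ℚ) ^ (2 * p - 2 - m) = (k : ℚ) ^ (p - 1 - m) * (k : ℚ) ^ (p - 1) := by
    rw [← pow_add]; congr 1; omega
  rw [e]; ring

/-- **The Kummer/Adams step for an even exponent** `m ≥ 2`, `p ≥ m + 3`:
`v_p((m+2) p B_{p−1−m} − (m+1) p B_{2p−2−m}) ≤ exp(−2)`, from Kummer's congruence
`B_{p−1−m}/(p−1−m) ≡ B_{2p−2−m}/(2p−2−m) (mod p)` and Adams' `p`-integrality of `B_{p−1−m}/(p−1−m)`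
(`(m+1)(2p−2−m) − pm = (m+2)(p−1−m)`). [cite: IrelandRosen1982, Ch. 15 §2 Thm. 5 and Prop. 15.2.4 (inputs)] -/
theorem padicValuation_kummer_step_le_gen {m : ℕ} (hm : Even m) (hm2 : 2 ≤ m) (hmp : m + 3 ≤ p) :
    Rat.padicValuation p (((m : ℚ) + 2) * p * bernoulli (p - 1 - m) - ((m : ℚ) + 1) * p * bernoulli (2 * p - 2 - m))
      ≤ exp (-2) := by
  have h2 : p ≠ 2 := by omega
  have hev : Even (p - 1 - m) := by
    rw [Nat.even_sub (by omega)]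
    exact iff_of_true (hp.out.even_sub_one h2) hm
  have hnd : ¬ (p - 1) ∣ (p - 1 - m) := fun h ↦ by have := Nat.le_of_dvd (by omega) h; omega
  have hmm : p - 1 - m ≡ 2 * p - 2 - m [MOD p - 1] := by
    rw [show 2 * p - 2 - m = (p - 1 - m) + (p - 1) by omega]; exact (Nat.add_modEq_right).symm
  have hK := kummer_congruence_one (p := p) hev hnd hmm
  have hA := padicValuation_bernoulli_div_le_one (p := p) hev hnd
  set B₁ := bernoulli (p - 1 - m) with hB₁
  set B₂ := bernoulli (2 * p - 2 - m) with hB₂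
  have hM₁ : ((p - 1 - m : ℕ) : ℚ) = (p : ℚ) - 1 - m := by
    rw [Nat.cast_sub (by omega), Nat.cast_sub (by omega)]; push_cast; ring
  have hM₂ : ((2 * p - 2 - m : ℕ) : ℚ) = 2 * (p : ℚ) - 2 - m := by
    rw [Nat.cast_sub (by omega), Nat.cast_sub (by omega)]; push_cast; ring
  rw [hM₁] at hK hA
  rw [hM₂] at hK
  have hM₁0 : (p : ℚ) - 1 - m ≠ 0 := by
    have : ((m : ℚ)) + 1 < p := by exact_mod_cast (show m + 1 < p by omega)
    linarith
  have hM₂0 : 2 * (p : ℚ) - 2 - m ≠ 0 := by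
    have : ((m : ℚ)) + 2 < 2 * p := by exact_mod_cast (show m + 2 < 2 * p by omega)
    linarith
  -- the identity
  have e1 : (2 * (p : ℚ) - 2 - m) * (B₂ / (2 * (p : ℚ) - 2 - m)) = B₂ := mul_div_cancel₀ _ hM₂0
  have e2 : ((p : ℚ) - 1 - m) * (B₁ / ((p : ℚ) - 1 - m)) = B₁ := mul_div_cancel₀ _ hM₁0
  have hid : ((m : ℚ) + 2) * p * B₁ - ((m : ℚ) + 1) * p * B₂ =
      p * ((m : ℚ) + 1) * (2 * (p : ℚ) - 2 - m) * (B₁ / ((p : ℚ) - 1 - m) - B₂ / (2 * (p : ℚ) - 2 - m)) -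
        (p : ℚ) ^ 2 * ((m : ℚ) * (B₁ / ((p : ℚ) - 1 - m))) := by
    linear_combination ((p : ℚ) * ((m : ℚ) + 1)) * e1 + (-(((m : ℚ) + 2) * p)) * e2
  rw [hid]
  -- valuations of the two pieces
  have hp1 : Rat.padicValuation p (p : ℚ) = exp (-1) := Rat.padicValuation_self p
  have hvm1 : Rat.padicValuation p ((m : ℚ) + 1) ≤ 1 := by
    exact_mod_cast padicValuation_natCast_le_one (p := p) (m + 1)
  have hvM₂ : Rat.padicValuation p (2 * (p : ℚ) - 2 - m) ≤ 1 := by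
    rw [← hM₂]; exact padicValuation_natCast_le_one _
  have hvm : Rat.padicValuation p (m : ℚ) ≤ 1 := padicValuation_natCast_le_one (p := p) m
  refine Valuation.map_sub_le _ ?_ ?_
  · rw [map_mul, map_mul, map_mul, hp1]
    calc exp (-1) * Rat.padicValuation p ((m : ℚ) + 1) * Rat.padicValuation p (2 * (p : ℚ) - 2 - m) *
          Rat.padicValuation p (B₁ / ((p : ℚ) - 1 - m) - B₂ / (2 * (p : ℚ) - 2 - m))
        ≤ exp (-1) * 1 * 1 * exp (-1) := by gcongr
      _ = exp (-2) := by rw [mul_one, mul_one, ← exp_add]; norm_num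
  · rw [map_mul, padicValuation_prime_sq, map_mul]
    calc exp (-2) * (Rat.padicValuation p (m : ℚ) * Rat.padicValuation p (B₁ / ((p : ℚ) - 1 - m)))
        ≤ exp (-2) * (1 * 1) := by gcongr
      _ = exp (-2) := by rw [mul_one, mul_one]

/-- **Glaisher (1900), the even half of [Mestrovic2011, (20)]: for every EVEN `m ≥ 2` and every prime `p ≥ m + 3`,
`Σ_{k=1}^{p−1} 1/k^m ≡ (m/(m+1)) p B_{p−1−m} (mod p²)`**, i.e.
`v_p(Σ_{0<k<p} k^{−m} − (m/(m+1)) p B_{p−1−m}) ≤ exp(−2)`. [cite: Mestrovic2011, eq. (20), even case (Glaisher 1900 [gl2])] -/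
theorem padicValuation_sum_inv_pow_sub_le {m : ℕ} (hm : Even m) (hm2 : 2 ≤ m) (hmp : m + 3 ≤ p) :
    Rat.padicValuation p (∑ k ∈ Ico 1 p, ((k : ℚ)⁻¹) ^ m - ((m : ℚ) / ((m : ℚ) + 1)) * p * bernoulli (p - 1 - m))
      ≤ exp (-2) := by
  have h5 : 5 ≤ p := by omega
  have h2 : p ≠ 2 := by omega
  have hev : Even (p - 1 - m) := by
    rw [Nat.even_sub (by omega)]
    exact iff_of_true (hp.out.even_sub_one h2) hm
  -- the four pieces
  set A : ℚ := ∑ k ∈ Ico 1 p, (((k : ℚ)⁻¹) ^ m - (k : ℚ) ^ (p - 1 - m) * (2 - (k : ℚ) ^ (p - 1))) with hAdef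
  set D₁ : ℚ := (∑ t ∈ range p, (t : ℚ) ^ (p - 1 - m)) - p * bernoulli (p - 1 - m) with hD₁
  set D₂ : ℚ := (∑ t ∈ range p, (t : ℚ) ^ (2 * p - 2 - m)) - p * bernoulli (2 * p - 2 - m) with hD₂
  set L : ℚ := ((m : ℚ) + 2) * p * bernoulli (p - 1 - m) - ((m : ℚ) + 1) * p * bernoulli (2 * p - 2 - m) with hL
  have hAv : Rat.padicValuation p A ≤ exp (-2) :=
    Valuation.map_sum_le _ fun k hk ↦ by
      rw [Finset.mem_Ico] at hk
      exact padicValuation_inv_pow_sub_le (by omega) (by omega) hk.1 hk.2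
  have hD₁v : Rat.padicValuation p D₁ ≤ exp (-2) := padicValuation_sum_range_pow_sub_le h5 hev (by omega)
  have hD₂v : Rat.padicValuation p D₂ ≤ exp (-2) :=
    padicValuation_sum_range_pow_sub_le h5
      (by rw [show 2 * p - 2 - m = (p - 1 - m) + (p - 1) by omega]; exact hev.add (hp.out.even_sub_one h2))
      (by omega)
  have hLv : Rat.padicValuation p L ≤ exp (-2) := padicValuation_kummer_step_le_gen hm hm2 hmp
  have hv2 : Rat.padicValuation p (2 : ℚ) ≤ 1 := by exact_mod_cast padicValuation_natCast_le_one (p := p) 2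
  -- `m + 1` is a `p`-adic unit
  have hm1 : ((m : ℚ) + 1) ≠ 0 := by positivity
  have hvm1 : Rat.padicValuation p (((m : ℚ) + 1)⁻¹) = 1 := by
    have h := padicValuation_natCast_eq_one (p := p) (n := m + 1)
      (fun h ↦ by have := Nat.le_of_dvd (by omega) h; omega)
    push_cast at h
    rw [map_inv₀, h, inv_one]
  -- the decomposition
  have hA : A = (∑ k ∈ Ico 1 p, ((k : ℚ)⁻¹) ^ m) -
      (2 * ∑ t ∈ range p, (t : ℚ) ^ (p - 1 - m) - ∑ t ∈ range p, (t : ℚ) ^ (2 * p - 2 - m)) := by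
    rw [hAdef, Finset.sum_sub_distrib, sum_Ico_pow_mul_eq_gen (by omega)]
  have hu : ((m : ℚ) + 1)⁻¹ * ((m : ℚ) + 1) = 1 := inv_mul_cancel₀ hm1
  have key : (∑ k ∈ Ico 1 p, ((k : ℚ)⁻¹) ^ m) - ((m : ℚ) / ((m : ℚ) + 1)) * p * bernoulli (p - 1 - m) =
      A + (2 * D₁ - D₂) + ((m : ℚ) + 1)⁻¹ * L := by
    rw [hA, hD₁, hD₂, hL, div_eq_mul_inv]
    linear_combination ((p : ℚ) * bernoulli (2 * p - 2 - m) - 2 * (p : ℚ) * bernoulli (p - 1 - m)) * hu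
  rw [key]
  refine Valuation.map_add_le _ (Valuation.map_add_le _ hAv (Valuation.map_sub_le _ ?_ hD₂v)) ?_
  · rw [map_mul]
    calc Rat.padicValuation p 2 * Rat.padicValuation p D₁ ≤ 1 * exp (-2) := by gcongr
      _ = exp (-2) := one_mul _
  · rw [map_mul, hvm1, one_mul]; exact hLv

/-! ### The odd half of (20) -/

/-- `v_p(1/k^e − k^{p−1−e}) ≤ exp(−1)` for `0 < k < p`, `1 ≤ e ≤ p − 1` (`k^e·k^{p−1−e} = k^{p−1} ≡ 1`). [folklore] -/
private theorem padicValuation_inv_pow_sub_pow_le {e : ℕ} (he : e + 1 ≤ p) {k : ℕ} (hk1 : 1 ≤ k) (hkp : k < p) :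
    Rat.padicValuation p (((k : ℚ)⁻¹) ^ e - (k : ℚ) ^ (p - 1 - e)) ≤ exp (-1) := by
  have hpk : ¬ p ∣ k := fun h ↦ by have := Nat.le_of_dvd (by omega) h; omega
  have hk0 : (k : ℚ) ≠ 0 := by exact_mod_cast (show k ≠ 0 by omega)
  have hcop : IsCoprime (k : ℤ) (p : ℤ) :=
    Nat.isCoprime_iff_coprime.2 ((Nat.Prime.coprime_iff_not_dvd hp.out).2 hpk).symm
  obtain ⟨q, hq⟩ := (Int.ModEq.pow_card_sub_one_eq_one hp.out hcop).symm.dvd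
  have hF : (k : ℚ) ^ (p - 1) = 1 + (p : ℚ) * q := by
    have h := congrArg (Int.cast (R := ℚ)) hq
    push_cast at h
    linear_combination h
  have hsplit : (k : ℚ) ^ (p - 1) = (k : ℚ) ^ (p - 1 - e) * (k : ℚ) ^ e := by
    rw [← pow_add]; congr 1; omega
  have hke : (k : ℚ) ^ e * ((k : ℚ)⁻¹) ^ e = 1 := by rw [← mul_pow, mul_inv_cancel₀ hk0, one_pow]
  have hid : ((k : ℚ)⁻¹) ^ e - (k : ℚ) ^ (p - 1 - e) = -(p : ℚ) * ((q : ℚ) * ((k : ℚ)⁻¹) ^ e) := by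
    have e1 : (k : ℚ) ^ (p - 1 - e) = (1 + (p : ℚ) * q) * ((k : ℚ)⁻¹) ^ e := by
      rw [← hF, hsplit]
      linear_combination (-(k : ℚ) ^ (p - 1 - e)) * hke
    rw [e1]; ring
  rw [hid, map_mul, Valuation.map_neg, Rat.padicValuation_self, map_mul, map_pow,
    padicValuation_inv_natCast' hk1 hkp, one_pow, mul_one]
  calc exp (-1) * Rat.padicValuation p (q : ℚ) ≤ exp (-1) * 1 := by
        gcongr; rw [Rat.padicValuation_cast]; exact Int.padicValuation_le_one p q
    _ = exp (-1) := mul_one _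

/-- `v_p(Σ_{0<k<p} k^j) ≤ exp(−1)` for `0 < j < p − 1` (Theorem 119: `Σ_{x ∈ 𝔽_p} x^j = 0`). [folklore] -/
private theorem padicValuation_sum_pow_le_gen {j : ℕ} (hj0 : 0 < j) (hj : j < p - 1) :
    Rat.padicValuation p (∑ k ∈ Ico 1 p, (k : ℚ) ^ j) ≤ exp (-1) := by
  have hnat : (∑ k ∈ Ico 1 p, (k : ℚ) ^ j) = ((∑ k ∈ Ico 1 p, k ^ j : ℕ) : ℚ) := by push_cast; rfl
  rw [hnat]
  refine padicValuation_natCast_le_of_dvd ?_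
  rw [← ZMod.natCast_eq_zero_iff, Nat.cast_sum]
  have hzm : ∑ x : ZMod p, x ^ j = ∑ m ∈ range p, ((m : ℕ) : ZMod p) ^ j := by
    refine (Finset.sum_nbij' (fun m : ℕ ↦ (m : ZMod p)) (fun x : ZMod p ↦ x.val) ?_ ?_ ?_ ?_ ?_).symm
    · intro m _; exact Finset.mem_univ _
    · intro x _; exact Finset.mem_range.mpr (ZMod.val_lt x)
    · intro m hm; exact ZMod.val_cast_of_lt (Finset.mem_range.mp hm)
    · intro x _; exact ZMod.natCast_zmod_val x
    · intro m _; rfl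
  have h0 : ∑ m ∈ range p, ((m : ℕ) : ZMod p) ^ j = ∑ m ∈ Ico 1 p, ((m : ℕ) : ZMod p) ^ j := by
    rw [Finset.range_eq_Ico, Finset.sum_eq_sum_Ico_succ_bot hp.out.pos]
    simp; omega
  have h := FiniteField.sum_pow_lt_card_sub_one (ZMod p) j (by rw [ZMod.card]; exact hj)
  rw [hzm, h0] at h
  push_cast
  exact h

/-- `v_p(Σ_{0<k<p} k^{−e}) ≤ exp(−1)` for `1 ≤ e ≤ p − 2` (Theorem 119 for the exponent `−e`). [folklore] -/
private theorem padicValuation_sum_inv_pow_le_gen {e : ℕ} (he1 : 1 ≤ e) (he : e + 2 ≤ p) :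
    Rat.padicValuation p (∑ k ∈ Ico 1 p, ((k : ℚ)⁻¹) ^ e) ≤ exp (-1) := by
  have eq : (∑ k ∈ Ico 1 p, ((k : ℚ)⁻¹) ^ e) =
      (∑ k ∈ Ico 1 p, (((k : ℚ)⁻¹) ^ e - (k : ℚ) ^ (p - 1 - e))) + ∑ k ∈ Ico 1 p, (k : ℚ) ^ (p - 1 - e) := by
    rw [← Finset.sum_add_distrib]
    exact Finset.sum_congr rfl fun k _ ↦ by ring
  rw [eq]
  refine Valuation.map_add_le _ (Valuation.map_sum_le _ fun k hk ↦ ?_)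
    (padicValuation_sum_pow_le_gen (by omega) (by omega))
  rw [Finset.mem_Ico] at hk
  exact padicValuation_inv_pow_sub_pow_le (by omega) hk.1 hk.2

/-- `2·C(m,2) = m² − m` in `ℚ`. [folklore] -/
private theorem two_mul_cast_choose_two (m : ℕ) : 2 * ((m.choose 2 : ℕ) : ℚ) = (m : ℚ) ^ 2 - m := by
  induction m with
  | zero => simp
  | succ m ih =>
    rw [Nat.choose_succ_succ', Nat.choose_one_right]
    push_cast
    linear_combination ih

/-- Second-order binomial expansion with a `p`-integral remainder: for `v_p(x) ≤ 1` and every `m`,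
`(1 − x)^m = 1 − m x + C(m,2) x² − x³ s` for some `s` with `v_p(s) ≤ 1`
(`s_{m+1} = C(m,2) + (1 − x) s_m`). [folklore] -/
private theorem exists_one_sub_pow_eq {x : ℚ} (hx : Rat.padicValuation p x ≤ 1) (m : ℕ) :
    ∃ s : ℚ, Rat.padicValuation p s ≤ 1 ∧
      (1 - x) ^ m = 1 - m * x + (m.choose 2 : ℕ) * x ^ 2 - x ^ 3 * s := by
  induction m with
  | zero => exact ⟨0, by simp, by simp⟩
  | succ m ih =>
    obtain ⟨s, hs, hsm⟩ := ih
    refine ⟨(m.choose 2 : ℕ) + (1 - x) * s, ?_, ?_⟩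
    · refine Valuation.map_add_le _ (padicValuation_natCast_le_one _) ?_
      rw [map_mul]
      calc Rat.padicValuation p (1 - x) * Rat.padicValuation p s ≤ 1 * 1 := by
            gcongr
            exact Valuation.map_sub_le _ (by rw [map_one]) hx
        _ = 1 := one_mul _
    · have hc : (((m + 1).choose 2 : ℕ) : ℚ) = (m.choose 2 : ℕ) + m := by
        rw [Nat.choose_succ_succ', Nat.choose_one_right]; push_cast; ring
      rw [pow_succ, hsm, hc]
      push_cast
      ring

/-- **Glaisher's pairing to second order**: for an odd exponent `m` and `0 < k < p`,
`v_p(1/(p−k)^m + 1/k^m + m p/k^{m+1} + (m(m+1)/2) p²/k^{m+2}) ≤ exp(−3)` — i.e.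
`1/(p−k)^m ≡ −k^{−m}(1 + m(p/k) + C(m+1,2)(p/k)²) (mod p³)`. [cite: Mestrovic2011, eq. (20) (proof input)] -/
theorem padicValuation_pairing_pow_le {m : ℕ} (hm : Odd m) {k : ℕ} (hk1 : 1 ≤ k) (hkp : k < p) :
    Rat.padicValuation p ((((p : ℚ) - k)⁻¹) ^ m + ((k : ℚ)⁻¹) ^ m + m * p * ((k : ℚ)⁻¹) ^ (m + 1) +
      ((m : ℚ) * ((m : ℚ) + 1) / 2) * (p : ℚ) ^ 2 * ((k : ℚ)⁻¹) ^ (m + 2)) ≤ exp (-3) := by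
  have hk0 : (k : ℚ) ≠ 0 := by exact_mod_cast (show k ≠ 0 by omega)
  have hpk0 : ¬ p ∣ p - k := fun h ↦ by have := Nat.le_of_dvd (by omega) h; omega
  -- `x = p/k`: `v(x) = exp(−1)`
  have hvx : Rat.padicValuation p ((p : ℚ) * (k : ℚ)⁻¹) = exp (-1) := by
    rw [map_mul, Rat.padicValuation_self, padicValuation_inv_natCast' hk1 hkp, mul_one]
  have hvx1 : Rat.padicValuation p ((p : ℚ) * (k : ℚ)⁻¹) ≤ 1 := by rw [hvx]; exact le_of_lt (by decide)
  obtain ⟨s, hs, hsm⟩ := exists_one_sub_pow_eq (p := p) hvx1 m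
  -- `y = (1 − x)^m` is a unit and `(p − k)^{−m} = −k^{−m} y^{−1}` (`m` odd)
  have hy1 : 1 - (p : ℚ) * (k : ℚ)⁻¹ = -(((p - k : ℕ) : ℚ) * (k : ℚ)⁻¹) := by
    rw [Nat.cast_sub hkp.le]; field_simp; ring
  have hvy : Rat.padicValuation p ((1 - (p : ℚ) * (k : ℚ)⁻¹) ^ m) = 1 := by
    rw [map_pow, hy1, Valuation.map_neg, map_mul, padicValuation_inv_natCast' hk1 hkp,
      padicValuation_natCast_eq_one hpk0, one_mul, one_pow]
  have hy0 : (1 - (p : ℚ) * (k : ℚ)⁻¹) ^ m ≠ 0 := by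
    intro h0; rw [h0, map_zero] at hvy; exact zero_ne_one hvy
  have hinv : (1 - (p : ℚ) * (k : ℚ)⁻¹) ^ m * ((1 - (p : ℚ) * (k : ℚ)⁻¹) ^ m)⁻¹ = 1 := mul_inv_cancel₀ hy0
  have hpow : (((p : ℚ) - k)⁻¹) ^ m = -(((k : ℚ)⁻¹) ^ m * ((1 - (p : ℚ) * (k : ℚ)⁻¹) ^ m)⁻¹) := by
    have e : (p : ℚ) - k = -((k : ℚ) * (1 - (p : ℚ) * (k : ℚ)⁻¹)) := by field_simp; ring
    rw [e, inv_neg, hm.neg_pow, mul_inv, mul_pow]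
    simp only [inv_pow]
  -- binomial values
  have h2c : ((m.choose 2 : ℕ) : ℚ) = ((m : ℚ) ^ 2 - m) / 2 := by
    rw [eq_div_iff two_ne_zero, mul_comm]; exact two_mul_cast_choose_two m
  -- the identity: everything equals `x³ · W · k^{−m} · y^{−1}` with a `p`-integral `W`
  set W : ℚ := -((m : ℚ) ^ 2) + (m.choose 2 : ℕ) * (((m : ℚ) ^ 2 + m) / 2) * ((p : ℚ) * (k : ℚ)⁻¹) -
    s * (1 + m * ((p : ℚ) * (k : ℚ)⁻¹) + (((m : ℚ) ^ 2 + m) / 2) * ((p : ℚ) * (k : ℚ)⁻¹) ^ 2) with hW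
  have hid : (((p : ℚ) - k)⁻¹) ^ m + ((k : ℚ)⁻¹) ^ m + m * p * ((k : ℚ)⁻¹) ^ (m + 1) +
      ((m : ℚ) * ((m : ℚ) + 1) / 2) * (p : ℚ) ^ 2 * ((k : ℚ)⁻¹) ^ (m + 2) =
      ((p : ℚ) * (k : ℚ)⁻¹) ^ 3 * W * (((k : ℚ)⁻¹) ^ m * ((1 - (p : ℚ) * (k : ℚ)⁻¹) ^ m)⁻¹) := by
    rw [hpow, hW, h2c]
    rw [h2c] at hsm
    linear_combination
      (-(((k : ℚ)⁻¹) ^ m * (1 + m * ((p : ℚ) * (k : ℚ)⁻¹) +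
        (((m : ℚ) ^ 2 + m) / 2) * ((p : ℚ) * (k : ℚ)⁻¹) ^ 2))) * hinv +
      (((k : ℚ)⁻¹) ^ m * ((1 - (p : ℚ) * (k : ℚ)⁻¹) ^ m)⁻¹ * (1 + m * ((p : ℚ) * (k : ℚ)⁻¹) +
        (((m : ℚ) ^ 2 + m) / 2) * ((p : ℚ) * (k : ℚ)⁻¹) ^ 2)) * hsm
  -- valuation of `W`
  have hWv : Rat.padicValuation p W ≤ 1 := by
    have hm1 : Rat.padicValuation p (m : ℚ) ≤ 1 := padicValuation_natCast_le_one _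
    have hcc : Rat.padicValuation p (((m : ℚ) ^ 2 + m) / 2) ≤ 1 := by
      have e : ((m : ℚ) ^ 2 + m) / 2 = (((m + 1).choose 2 : ℕ) : ℚ) := by
        rw [div_eq_iff two_ne_zero, mul_comm, two_mul_cast_choose_two (m + 1)]; push_cast; ring
      rw [e]; exact padicValuation_natCast_le_one _
    refine Valuation.map_sub_le _ (Valuation.map_add_le _ ?_ ?_) ?_
    · rw [Valuation.map_neg, map_pow]; exact pow_le_one' hm1 _
    · rw [map_mul, map_mul]
      exact mul_le_one' (mul_le_one' (padicValuation_natCast_le_one _) hcc) hvx1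
    · rw [map_mul]
      refine mul_le_one' hs (Valuation.map_add_le _ (Valuation.map_add_le _ (by rw [map_one]) ?_) ?_)
      · rw [map_mul]; exact mul_le_one' hm1 hvx1
      · rw [map_mul, map_pow]; exact mul_le_one' hcc (pow_le_one' hvx1 _)
  rw [hid, map_mul, map_mul, map_mul, map_pow, hvx, map_inv₀, hvy, inv_one, mul_one, map_pow,
    padicValuation_inv_natCast' hk1 hkp, one_pow, mul_one, ← exp_nsmul]
  calc exp (3 • (-1 : ℤ)) * Rat.padicValuation p W ≤ exp (3 • (-1 : ℤ)) * 1 := by gcongr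
    _ = exp (-3) := by rw [mul_one]; norm_num

omit hp in
/-- Reflection: `Σ_{0<k<p} 1/(p−k)^m = Σ_{0<k<p} 1/k^m`. [folklore] -/
private theorem sum_Ico_inv_pow_reflect (m : ℕ) :
    ∑ k ∈ Ico 1 p, (((p : ℚ) - k)⁻¹) ^ m = ∑ k ∈ Ico 1 p, ((k : ℚ)⁻¹) ^ m := by
  refine Finset.sum_nbij' (fun k ↦ p - k) (fun k ↦ p - k) ?_ ?_ ?_ ?_ ?_
  · intro k hk; rw [Finset.mem_Ico] at hk ⊢; omega
  · intro k hk; rw [Finset.mem_Ico] at hk ⊢; omega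
  · intro k hk; rw [Finset.mem_Ico] at hk; omega
  · intro k hk; rw [Finset.mem_Ico] at hk; omega
  · intro k hk
    rw [Finset.mem_Ico] at hk
    rw [Nat.cast_sub (by omega)]

/-- **Glaisher (1900), the odd half of [Mestrovic2011, (20)]: for every ODD `m ≥ 3` and every prime `p ≥ m + 3`,
`Σ_{k=1}^{p−1} 1/k^m ≡ −(m(m+1)/(2(m+2))) p² B_{p−2−m} (mod p³)`**, i.e.
`v_p(Σ_{0<k<p} k^{−m} + (m(m+1)/(2(m+2))) p² B_{p−2−m}) ≤ exp(−3)` (the case `m = 1` is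
`padicValuation_harmonic_add_le`). [cite: Mestrovic2011, eq. (20), odd case (Glaisher 1900 [gl2])] -/
theorem padicValuation_sum_inv_pow_add_le_of_odd {m : ℕ} (hm : Odd m) (hm3 : 3 ≤ m) (hmp : m + 3 ≤ p) :
    Rat.padicValuation p (∑ k ∈ Ico 1 p, ((k : ℚ)⁻¹) ^ m +
      ((m : ℚ) * ((m : ℚ) + 1) / (2 * ((m : ℚ) + 2))) * (p : ℚ) ^ 2 * bernoulli (p - 2 - m)) ≤ exp (-3) := by
  -- parities: `p ≥ m + 4`
  have h2 : p ≠ 2 := by omega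
  have hpodd : Odd p := hp.out.odd_of_ne_two h2
  have hmp4 : m + 4 ≤ p := by
    obtain ⟨r, hr⟩ := hm
    obtain ⟨q, hq⟩ := hpodd
    omega
  have hm1e : Even (m + 1) := hm.add_one
  -- pieces
  set S : ℚ := ∑ k ∈ Ico 1 p, ((k : ℚ)⁻¹) ^ m with hS
  set S₁ : ℚ := ∑ k ∈ Ico 1 p, ((k : ℚ)⁻¹) ^ (m + 1) with hS₁
  set S₂ : ℚ := ∑ k ∈ Ico 1 p, ((k : ℚ)⁻¹) ^ (m + 2) with hS₂
  set T : ℚ := ∑ k ∈ Ico 1 p, ((((p : ℚ) - k)⁻¹) ^ m + ((k : ℚ)⁻¹) ^ m + m * p * ((k : ℚ)⁻¹) ^ (m + 1) +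
      ((m : ℚ) * ((m : ℚ) + 1) / 2) * (p : ℚ) ^ 2 * ((k : ℚ)⁻¹) ^ (m + 2)) with hT
  set B : ℚ := bernoulli (p - 2 - m) with hB
  set E : ℚ := S₁ - (((m + 1 : ℕ) : ℚ) / (((m + 1 : ℕ) : ℚ) + 1)) * p * bernoulli (p - 1 - (m + 1)) with hE
  have hTv : Rat.padicValuation p T ≤ exp (-3) :=
    Valuation.map_sum_le _ fun k hk ↦ by
      rw [Finset.mem_Ico] at hk
      exact padicValuation_pairing_pow_le hm hk.1 hk.2
  have hEv : Rat.padicValuation p E ≤ exp (-2) := padicValuation_sum_inv_pow_sub_le hm1e (by omega) (by omega)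
  have hS₂v : Rat.padicValuation p S₂ ≤ exp (-1) := padicValuation_sum_inv_pow_le_gen (by omega) (by omega)
  -- `T = 2S + m p S₁ + (m(m+1)/2) p² S₂`
  have hTeq : T = 2 * S + m * p * S₁ + ((m : ℚ) * ((m : ℚ) + 1) / 2) * (p : ℚ) ^ 2 * S₂ := by
    rw [hT, Finset.sum_add_distrib, Finset.sum_add_distrib, Finset.sum_add_distrib, sum_Ico_inv_pow_reflect,
      ← Finset.mul_sum, ← Finset.mul_sum, hS, hS₁, hS₂]
    ring
  -- the identity `2(S + (m(m+1)/(2(m+2))) p² B) = T − m p E − (m(m+1)/2) p² S₂`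
  have hm2' : ((m : ℚ) + 2) ≠ 0 := by positivity
  have hm2'' : ((m : ℚ) + 1 + 1) ≠ 0 := by positivity
  have hB' : bernoulli (p - 1 - (m + 1)) = B := by rw [hB]; congr 1; omega
  have key : 2 * (S + ((m : ℚ) * ((m : ℚ) + 1) / (2 * ((m : ℚ) + 2))) * (p : ℚ) ^ 2 * B) =
      T - m * p * E - ((m : ℚ) * ((m : ℚ) + 1) / 2) * (p : ℚ) ^ 2 * S₂ := by
    rw [hTeq, hE, hB']
    push_cast
    field_simp
    ring
  have hv2 : Rat.padicValuation p (2 : ℚ) = 1 := by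
    rw [show (2 : ℚ) = ((2 : ℤ) : ℚ) by norm_num, Rat.padicValuation_cast, Int.padicValuation_eq_one_iff]
    intro h
    have := Int.le_of_dvd (by norm_num) h
    have : (6 : ℤ) ≤ p := by exact_mod_cast (show 6 ≤ p by omega)
    omega
  have hp1 : Rat.padicValuation p (p : ℚ) = exp (-1) := Rat.padicValuation_self p
  have hcoef : Rat.padicValuation p ((m : ℚ) * ((m : ℚ) + 1) / 2) ≤ 1 := by
    rw [map_div₀, hv2, div_one, map_mul]
    refine mul_le_one' (padicValuation_natCast_le_one _) ?_
    exact_mod_cast padicValuation_natCast_le_one (p := p) (m + 1)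
  have hmain : Rat.padicValuation p (2 * (S + ((m : ℚ) * ((m : ℚ) + 1) / (2 * ((m : ℚ) + 2))) *
      (p : ℚ) ^ 2 * B)) ≤ exp (-3) := by
    rw [key]
    refine Valuation.map_sub_le _ (Valuation.map_sub_le _ hTv ?_) ?_
    · rw [map_mul, map_mul, hp1]
      calc Rat.padicValuation p (m : ℚ) * exp (-1) * Rat.padicValuation p E ≤ 1 * exp (-1) * exp (-2) := by
            gcongr; exact padicValuation_natCast_le_one _
        _ = exp (-3) := by rw [one_mul, ← exp_add]; norm_num
    · rw [map_mul, map_mul, map_pow, hp1, ← exp_nsmul]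
      calc Rat.padicValuation p ((m : ℚ) * ((m : ℚ) + 1) / 2) * exp (2 • (-1 : ℤ)) * Rat.padicValuation p S₂
          ≤ 1 * exp (2 • (-1 : ℤ)) * exp (-1) := by gcongr
        _ = exp (-3) := by rw [one_mul, ← exp_add]; norm_num
  rwa [map_mul, hv2, one_mul] at hmain

end Literature.NumberTheory.Congruences.Glaisher
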